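import Summits.QuantumFields.QCD.Theses.SpectralDefectExtinction
import Summits.QuantumFields.QCD.Theorems.SpectralDefectExtinctionTipNoBindingStubPositivity
import Summits.QuantumFields.QCD.Theorems.SpectralDefectExtinctionTipNoBindingStubPerturbation

/-!
# Sketch for crux idea `bubble-barrier-minimum-principle` (crux `TipNoBinding`, item stmt-QuantumFields-8965)
crux-ideate round 1, ideator k = 2 (gen 2), planner-cruxidea-stmt-QuantumFields-8965-2-g2-0, 2026-08-16.

LEVER.  The regularised four-dimensional Newton potential ("bubble") `u_a(x) = 1/(a + |x|²)` is
DISCRETELY superharmonic on `ℤ⁴` as soon as `a ≥ 2` (first lemma `BubbleSuperharmonic`, pure algebra: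
superadditivity of `z ↦ 1/(c − z)` puts the worst case on a coordinate axis), and the finite MINIMUM
PRINCIPLE for `m² − Δ` on the torus (`torus_minimum_principle`, proved below) turns this pointwise fact
into a two-sided pointwise bound on the massive scalar torus Green kernel
`0 ≤ G_m(x,y) ≤ (a(a+1)/8)·(A + u_a(x − y))`, `A = 256/(m²L²)` (`GreenKernelBound`), the additive constant `A`
paying for the wrap-around of the torus exactly when `m²L² → ∞` — which is what the crux's floor `t ≥ 1/√L`
provides (`m² ∈ {1/L, t²/(1−t)}`).

STATUS (v6): PROVED in this file (rc 0, 0 sorries, 0 warnings, axioms propext/Classical.choice/Quot.sound):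
`BubbleSuperharmonic` (the `ℤ⁴` first lemma, `bubbleSuperharmonic_holds`), `BubbleBarrierTorus` (torus barrier, `L₁ = 16`,
`bubbleBarrierTorus_holds`), `GreenKernelBound` (`greenKernelBound_holds`) AND `SpreadBarrier` (`spreadBarrier_holds`: unique
solvability of `K g = h` via the minimum principle + `LinearMap.injective_iff_surjective`, summation by parts, Cauchy–Schwarz in
the `K`-form, the comparison bound `solution_abs_le` against translates of the barrier, Cauchy–Schwarz on `S`).  What remains
for the line: ONLY the two finite-algebra hypotheses `HoleDominatesLaplacian` (free SOS, shared with two filed cards; only its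
adjoint half is used) and `Diamagnetic` (= the registered `stub_diamagnetic`): `NoLeakBarrier` is PROVED conditionally on SOS
(`noLeakBarrier_of_sos`, through the generic complex-matrix lemma `noLeak_of_adjoint_sos`) and the COMPOSITION is PROVED:
`theorem tipNoBinding_of_sos : HoleDominatesLaplacian → Diamagnetic → SpectralDefectExtinction.TipNoBinding` concludes the crux BY
NAME (imports the landed `stub_positivity` / `stub_perturbation`; axioms propext/Classical.choice/Quot.sound).  Schur tests then give both halves of the standing architecture:
SPREAD (`SpreadBarrier`, by Cauchy–Schwarz in the `(m² − Δ)`-form against Kato's `E(|ψ|) ≤ 2t‖ψ‖²`) and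
NO-LEAK (`NoLeakBarrier`, through the sum-of-squares hole inequality `HoleDominatesLaplacian`), with NO Fourier
analysis, NO lattice Green constant `K_L`, NO Hardy/Sobolev inequality.

Everything is stated over tree vocabulary (`TorusSite`, `QuantumFieldTheory.Site.shift`, `wilsonDirac`,
`fundamentalRep`, `GaugeConfig`) + Mathlib (`ZMod.valMinAbs`, `Pi.single`).
-/

namespace Summit.QuantumFields.QCD.Cruxes.TipNoBinding.IdeasK2G2

open Literature.MathematicalPhysics Literature.MathematicalPhysics.QuantumLattice
  Literature.MathematicalPhysics.QuantumFieldTheory Literature.Probability.LatticeModels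
open Matrix Finset

noncomputable section

/-- The bubble on `ℤ⁴`: `u_a(x) = 1/(a + Σ_ν x_ν²)`. -/
def bubbleZ (a : ℝ) (x : Fin 4 → ℤ) : ℝ := 1 / (a + ∑ ν, ((x ν : ℤ) : ℝ) ^ 2)

/-- The bubble on the torus `(ℤ/L)⁴` through centred representatives: `u_a(x) = 1/(a + Σ_ν valMinAbs(x_ν)²)`. -/
def bubble (a : ℝ) {L : ℕ} (x : TorusSite 4 L) : ℝ :=
  1 / (a + ∑ ν, ((ZMod.valMinAbs (x ν) : ℤ) : ℝ) ^ 2)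

/-- The scalar massive graph Laplacian on the torus:
`(K_{m²} v)(x) = m² v(x) + Σ_μ (2 v(x) − v(x + e_μ) − v(x − e_μ))`. -/
def massiveLap {L : ℕ} (m2 : ℝ) (v : TorusSite 4 L → ℝ) (x : TorusSite 4 L) : ℝ :=
  m2 * v x + ∑ μ : Fin 4, (2 * v x - v (x + Pi.single μ 1) - v (x - Pi.single μ 1))

/-! ## First lemma (the only `d = 4` input of the line): the bubble is discretely superharmonic -/

/-- **FIRST LEMMA — `BubbleSuperharmonic`.**  For `a ≥ 2` and every `x ∈ ℤ⁴`,
`(−Δ u_a)(x) = Σ_μ [2u_a(x) − u_a(x+e_μ) − u_a(x−e_μ)] ≥ 0`.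
Proof sketch (checked with exact rationals on `|x|_∞ ≤ 12`, `a ∈ {2,3,4}`: 0 violations; `a < 2` fails on axes):
with `q = a + |x|²`, `c = q + 1`, `z_μ = 4x_μ²`:  `2u(x) − u(x+e_μ) − u(x−e_μ) = 2/q − 2c/(c² − z_μ)`;
`z ↦ 1/(c² − z) − 1/c²` is superadditive on `[0, c²)` (⇔ `z₁ z₂ ≥ 0`), so
`Σ_μ 1/(c² − z_μ) ≤ 3/c² + 1/(c² − 4|x|²)`, and then
`8/q − 6/c − 2c/(c² − 4|x|²) = [8(a−2)q + 8(4a+1)] / [q c (c² − 4|x|²)] ≥ 0`. -/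
def BubbleSuperharmonic : Prop :=
  ∀ a : ℝ, 2 ≤ a → ∀ x : Fin 4 → ℤ,
    0 ≤ ∑ μ : Fin 4, (2 * bubbleZ a x - bubbleZ a (x + Pi.single μ 1) - bubbleZ a (x - Pi.single μ 1))

/-- Quantitative form (the axis lower bound, exact on coordinate axes):
`(−Δ u_a)(x) ≥ [8(a−2)q + 8(4a+1)] / [q (q+1) ((q+1)² − 4|x|²)]`, `q = a + |x|²`. -/
def BubbleSuperharmonicQuant : Prop :=
  ∀ a : ℝ, 2 ≤ a → ∀ x : Fin 4 → ℤ,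
    (8 * (a - 2) * (a + ∑ ν, ((x ν : ℤ) : ℝ) ^ 2) + 8 * (4 * a + 1)) /
        ((a + ∑ ν, ((x ν : ℤ) : ℝ) ^ 2) * (a + 1 + ∑ ν, ((x ν : ℤ) : ℝ) ^ 2) *
          ((a + 1 + ∑ ν, ((x ν : ℤ) : ℝ) ^ 2) ^ 2 - 4 * ∑ ν, ((x ν : ℤ) : ℝ) ^ 2)) ≤
      ∑ μ : Fin 4, (2 * bubbleZ a x - bubbleZ a (x + Pi.single μ 1) - bubbleZ a (x - Pi.single μ 1))

/-! ## The minimum principle and the kernel comparison (PROVED: this is the whole "torus" technology) -/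

/-- **Finite minimum principle** for `K = m² − Δ` on the torus (`m² > 0`): `K v ≥ 0 ⇒ v ≥ 0`.
At a minimum point every `v(x₀) − v(neighbour) ≤ 0`, so `(Kv)(x₀) ≤ m² v(x₀)`. -/
theorem torus_minimum_principle {L : ℕ} [NeZero L] (m2 : ℝ) (hm : 0 < m2)
    (v : TorusSite 4 L → ℝ) (h : ∀ x, 0 ≤ massiveLap m2 v x) : ∀ x, 0 ≤ v x := by
  classical
  obtain ⟨x₀, -, hx₀⟩ := Finset.exists_min_image Finset.univ v Finset.univ_nonempty
  have hmin : ∀ y, v x₀ ≤ v y := fun y => hx₀ y (Finset.mem_univ y)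
  have h0 : 0 ≤ v x₀ := by
    by_contra hneg
    have hneg : v x₀ < 0 := lt_of_not_ge hneg
    have hsum : ∑ μ : Fin 4, (2 * v x₀ - v (x₀ + Pi.single μ 1) - v (x₀ - Pi.single μ 1)) ≤ 0 := by
      apply Finset.sum_nonpos
      intro μ _
      have h1 := hmin (x₀ + Pi.single μ 1)
      have h2 := hmin (x₀ - Pi.single μ 1)
      linarith
    have hK := h x₀
    unfold massiveLap at hK
    have hneg' : m2 * v x₀ < 0 := mul_neg_of_pos_of_neg hm hneg
    linarith
  intro x
  exact h0.trans (hmin x)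

/-- `massiveLap` is linear (the form used below). -/
theorem massiveLap_smul_sub {L : ℕ} (m2 s : ℝ) (w₁ w₂ : TorusSite 4 L → ℝ) (x : TorusSite 4 L) :
    massiveLap m2 (fun y => s * w₁ y - w₂ y) x = s * massiveLap m2 w₁ x - massiveLap m2 w₂ x := by
  simp only [massiveLap]
  have hμ : ∀ μ : Fin 4,
      (2 * (s * w₁ x - w₂ x) - (s * w₁ (x + Pi.single μ 1) - w₂ (x + Pi.single μ 1)) -
          (s * w₁ (x - Pi.single μ 1) - w₂ (x - Pi.single μ 1))) =
        s * (2 * w₁ x - w₁ (x + Pi.single μ 1) - w₁ (x - Pi.single μ 1)) -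
          (2 * w₂ x - w₂ (x + Pi.single μ 1) - w₂ (x - Pi.single μ 1)) := fun μ => by ring
  simp only [hμ, Finset.sum_sub_distrib, ← Finset.mul_sum]
  ring

/-- **Kernel comparison** (barrier argument): if `K G = δ₀`, `K u ≥ 0` off the origin and `(K u)(0) ≥ c > 0`,
then `0 ≤ G ≤ u/c` pointwise.  Both inequalities are the minimum principle, applied to `G` and to `u/c − G`. -/
theorem kernel_comparison {L : ℕ} [NeZero L] (m2 : ℝ) (hm : 0 < m2) (G u : TorusSite 4 L → ℝ)
    (c : ℝ) (hc : 0 < c) (hG : ∀ x, massiveLap m2 G x = if x = 0 then 1 else 0)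
    (hu : ∀ x, x ≠ 0 → 0 ≤ massiveLap m2 u x) (hu0 : c ≤ massiveLap m2 u 0) :
    ∀ x, 0 ≤ G x ∧ G x ≤ u x / c := by
  have hGpos : ∀ x, 0 ≤ G x := by
    refine torus_minimum_principle m2 hm G fun x => ?_
    rw [hG x]
    split_ifs <;> norm_num
  have hcomp : ∀ x, 0 ≤ (1 / c) * u x - G x := by
    refine torus_minimum_principle m2 hm (fun y => (1 / c) * u y - G y) fun x => ?_
    rw [massiveLap_smul_sub, hG x]
    by_cases hx : x = 0
    · subst hx
      rw [if_pos rfl]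
      have : 1 ≤ 1 / c * massiveLap m2 u 0 := by
        rw [one_div, le_inv_mul_iff₀ hc, mul_one]
        exact hu0
      linarith
    · rw [if_neg hx, sub_zero]
      exact mul_nonneg (by positivity) (hu x hx)
  intro x
  refine ⟨hGpos x, ?_⟩
  have := hcomp x
  rw [div_eq_mul_one_div, mul_comm]
  linarith

/-! ## The torus barrier and the Green kernel bound (stubs of the line; the floor is spent HERE) -/

/-- **`BubbleBarrierTorus`** (PROVED below as `bubbleBarrierTorus_holds`, `L₁ = 16`): for `L ≥ L₁` and every mass `m² ≥ 1/L`, the function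
`ū = A + u_3`, `A = 256/(m²L²)`, is a supersolution off the origin, `(K_{m²} ū)(x) ≥ 0` for `x ≠ 0`, with
`(K_{m²} ū)(0) ≥ (−Δu_3)(0) = 8/(3·4) = 2/3`.  Why true: NEAR region (all `|valMinAbs x_μ| ≤ L/4`, no wrap-around):
`(−Δu_3)(x) ≥ 0` is `BubbleSuperharmonic` verbatim; FAR region (`|x|² ≥ L²/16`): the crude bound
`(−Δu)(x) ≥ −Σ_{y∼x} u(y) ≥ −8/((L/4 − 1)² + 3) ≥ −256/L²` (for `L ≥ 16`) is absorbed by the mass term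
`m²A = 256/L²`.  (Numerically the smallest admissible `A` sits at the seam points `(0,0,0,L/2)` and is
`0.55, 0.37, 0.25` for `L = 6, 8, 10`, `m² = 1/L` — far below `256/(m²L²)`; toy/kernel_check.py.) -/
def BubbleBarrierTorus : Prop :=
  ∃ L₁ : ℕ, ∀ (L : ℕ) [NeZero L], L₁ ≤ L → ∀ m2 : ℝ, 1 / (L : ℝ) ≤ m2 →
    (∀ x : TorusSite 4 L, x ≠ 0 →
        0 ≤ massiveLap m2 (fun y => 256 / (m2 * (L : ℝ) ^ 2) + bubble 3 y) x) ∧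
      2 / 3 ≤ massiveLap m2 (fun y : TorusSite 4 L => 256 / (m2 * (L : ℝ) ^ 2) + bubble 3 y) 0

/-- **`GreenKernelBound`** (PROVED below as `greenKernelBound_holds` = `bubbleBarrierTorus_holds` + `kernel_comparison`, `c = 2/3`): the massive scalar torus
Green kernel is pointwise between `0` and `(3/2)(256/(m²L²) + 1/(3 + |x − y|²))` for every `m² ≥ 1/L`,
`L ≥ L₁` — uniformly in `m`, with the Newtonian `|x|⁻²` decay, and with the zero mode visible only as the
additive constant `384/(m²L²) → 0`. -/
def GreenKernelBound : Prop :=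
  ∃ L₁ : ℕ, ∀ (L : ℕ) [NeZero L], L₁ ≤ L → ∀ m2 : ℝ, 1 / (L : ℝ) ≤ m2 →
    ∀ G : TorusSite 4 L → ℝ, (∀ x, massiveLap m2 G x = if x = 0 then 1 else 0) →
      ∀ x, 0 ≤ G x ∧ G x ≤ (3 / 2) * (256 / (m2 * (L : ℝ) ^ 2) + bubble 3 x)

/-- `GreenKernelBound` follows from the torus barrier by the (proved) kernel comparison. -/
theorem greenKernelBound_of_barrier (h : BubbleBarrierTorus) : GreenKernelBound := by
  obtain ⟨L₁, hL₁⟩ := h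
  refine ⟨max L₁ 1, fun L _ hL m2 hm2 G hG x => ?_⟩
  have hL' : L₁ ≤ L := le_trans (le_max_left _ _) hL
  have hLpos : (0 : ℝ) < L := by
    have : 1 ≤ L := le_trans (le_max_right _ _) hL
    exact_mod_cast this
  have hm : 0 < m2 := lt_of_lt_of_le (by positivity) hm2
  obtain ⟨hoff, h0⟩ := hL₁ L hL' m2 hm2
  have hk := kernel_comparison m2 hm G (fun y => 256 / (m2 * (L : ℝ) ^ 2) + bubble 3 y) (2 / 3)
    (by norm_num) hG hoff h0 x
  refine ⟨hk.1, ?_⟩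
  have : (256 / (m2 * (L : ℝ) ^ 2) + bubble 3 x) / (2 / 3) =
      (3 / 2) * (256 / (m2 * (L : ℝ) ^ 2) + bubble 3 x) := by ring
  rw [← this]
  exact hk.2

/-! ## The two halves of the crux, in the shapes the lead's composition consumes -/

/-- **`SpreadBarrier`** (replaces `stub_sobolevSup` + `stub_greenBound`; PROVED below as `spreadBarrier_holds`, `L₁ = 16`):
for real `f` on `(ℤ/L)⁴`, `L ≥ L₁`, and any site set `S`,
`Σ_{x∈S} f(x)² ≤ ((1/L)‖f‖² + E(f)) · (3/2)|S|(256/L + 1/3)`.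
Why true: `m_S = ⟨f, 1_S f⟩`, Cauchy–Schwarz in the positive form `⟨·,(m² − Δ)·⟩` with `m² = 1/L`,
`⟨h,(m²−Δ)⁻¹h⟩ ≤ (max_x Σ_{y∈S} G_m(x,y)) ‖h‖²` (Schur test, `G_m ≥ 0`) and `GreenKernelBound`
(`Σ_{y∈S}(3/2)(256 L/L² + u_3) ≤ (3/2)|S|(256/L + 1/3)`).  With Kato (`E(|ψ|) ≤ 2t‖ψ‖²`, the lead's
`stub_positivity` + `stub_diamagnetic`) and `1/L ≤ t²  ≤ t`: box mass `≤ 3t · C_S ‖ψ‖²`. -/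
def SpreadBarrier : Prop :=
  ∃ L₁ : ℕ, ∀ (L : ℕ) [NeZero L], L₁ ≤ L → ∀ (f : TorusSite 4 L → ℝ) (S : Finset (TorusSite 4 L)),
    ∑ x ∈ S, f x ^ 2 ≤
      ((1 / (L : ℝ)) * ∑ y, f y ^ 2 + ∑ y, ∑ μ, (f (QuantumFieldTheory.Site.shift y μ) - f y) ^ 2) *
        ((3 / 2) * S.card * (256 / (L : ℝ) + 1 / 3))

/-- **`HoleDominatesLaplacian`** (shared with cards `sos-scalar-domination` / `hardy-duality-tip`, conceded as
prior on this crux; size M, finite algebra): for the FREE massless `r = 1` operator, every real `t` and every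
spinor field `χ`, `‖(D₀ − t)χ‖² ≥ t²‖χ‖² + (1 − t)·Σ_{x,μ}‖χ(x+μ̂) − χ(x)‖²` (the sum-of-squares identity minus
the mixed square), and the same for the adjoint (normality of `D₀`). -/
def HoleDominatesLaplacian : Prop :=
  ∀ (L : ℕ) [NeZero L] (t : ℝ) (χ : TorusSite 4 L × Fin 3 × Fin 4 → ℂ),
    t ^ 2 * ∑ i, ‖χ i‖ ^ 2 +
        (1 - t) * ∑ x, ∑ μ, ∑ a, ∑ α, ‖χ (QuantumFieldTheory.Site.shift x μ, a, α) - χ (x, a, α)‖ ^ 2 ≤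
      ∑ i, ‖(wilsonDirac (fundamentalRep (Fin 3))
          (1 : GaugeConfig 4 L ↥(Matrix.specialUnitaryGroup (Fin 3) ℂ)) 0 1 *ᵥ χ - (t : ℂ) • χ) i‖ ^ 2 ∧
    t ^ 2 * ∑ i, ‖χ i‖ ^ 2 +
        (1 - t) * ∑ x, ∑ μ, ∑ a, ∑ α, ‖χ (QuantumFieldTheory.Site.shift x μ, a, α) - χ (x, a, α)‖ ^ 2 ≤
      ∑ i, ‖((wilsonDirac (fundamentalRep (Fin 3))
          (1 : GaugeConfig 4 L ↥(Matrix.specialUnitaryGroup (Fin 3) ℂ)) 0 1)ᴴ *ᵥ χ - (t : ℂ) • χ) i‖ ^ 2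

/-- **`NoLeakBarrier`** — the registered `stub_noLeak` SHAPE with the barrier constant `4|S|(256/L + 1/3)` in
place of `(1/L³ + 4K_L)|S|`.  PROVED below CONDITIONALLY on the adjoint half of `HoleDominatesLaplacian`
(`noLeakBarrier_of_sos`, via the generic complex-matrix lemma `noLeak_of_adjoint_sos`):
if `φ = D_W(1,0,1)ψ − tψ` vanishes off `S` and `1/√L ≤ t ≤ 1/4`, then `‖ψ‖² ≤ 4|S|(256/L + 1/3)‖φ‖²`.
Why true: `‖ψ‖² = Re⟨φ, v⟩` with `(D₀ᴴ − t)v = ψ` (solvable: `D₀ᴴ − t` injective by SOS); the scalar dual bound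
(minimum principle + PROVED kernel machinery, `m² = t²/(1−t) ≥ 1/L` — THIS is where the floor is spent) on the 24 real fields
`Re/Im v(·,a,α)`; Cauchy–Schwarz over components; SOS once more: `(1−t)·Σ Q(v) ≤ ‖ψ‖²`; hence
`‖ψ‖² ≤ 2·(3/2)|S|(256/(m²L²) + 1/3)‖φ‖²/(1−t) ≤ 4|S|(256/L + 1/3)‖φ‖²`. -/
def NoLeakBarrier : Prop :=
  ∃ L₁ : ℕ, ∀ (L : ℕ) [NeZero L], L₁ ≤ L → ∀ (t : ℝ), 1 / Real.sqrt (L : ℝ) ≤ t → t ≤ 1 / 4 →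
    ∀ (S : Finset (TorusSite 4 L)) (ψ : TorusSite 4 L × Fin 3 × Fin 4 → ℂ),
      (∀ i : TorusSite 4 L × Fin 3 × Fin 4, i.1 ∉ S →
        (wilsonDirac (fundamentalRep (Fin 3))
            (1 : GaugeConfig 4 L ↥(Matrix.specialUnitaryGroup (Fin 3) ℂ)) 0 1 *ᵥ ψ -
          (t : ℂ) • ψ) i = 0) →
      ∑ i, ‖ψ i‖ ^ 2 ≤
        (4 * S.card * (256 / (L : ℝ) + 1 / 3)) *
          ∑ i, ‖(wilsonDirac (fundamentalRep (Fin 3))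
              (1 : GaugeConfig 4 L ↥(Matrix.specialUnitaryGroup (Fin 3) ℂ)) 0 1 *ᵥ ψ -
            (t : ℂ) • ψ) i‖ ^ 2

/-- The explicit window of the line (|S|-form): chain `1 ≤ [4|S|B]·256·[3t·(3/2)|S|B] = 4608 |S|² B² t`,
`B = 256/L + 1/3 ≤ 1/2` for `L ≥ L₀ = 1536` (absolute), `|S| ≤ 5(2R+1)⁴`, i.e. `λ_R = 1/(1152·25(2R+1)⁸) = 1/(28800 (2R+1)⁸)`
(the `L → ∞` value is `1/(12800(2R+1)⁸)`); the geometric form replaces `|S|/3` by `Σ_{y ∈ box(R+1)} 1/(3+|y|²) ≍ 13(R+2)²`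
(λ_R ∝ R⁻⁴). -/
def lamOf (R : ℕ) : ℝ := 1 / (28800 * (2 * (R : ℝ) + 1) ^ 8)

theorem lamOf_pos (R : ℕ) : 0 < lamOf R := by
  unfold lamOf
  positivity


/-! ## Proof of the first lemma `BubbleSuperharmonic` (pure real algebra) -/

section BubbleProof

/-- Superadditivity of `z ↦ 1/(C − z) − 1/C` on `[0, C)`: the one-line heart of the `d = 4` input. -/
theorem inv_sub_superadd {C z₁ z₂ : ℝ} (hz₁ : 0 ≤ z₁) (hz₂ : 0 ≤ z₂) (h : z₁ + z₂ < C) :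
    1 / (C - z₁) + 1 / (C - z₂) ≤ 1 / C + 1 / (C - (z₁ + z₂)) := by
  have hC : 0 < C := by linarith
  have h1 : 0 < C - z₁ := by linarith
  have h2 : 0 < C - z₂ := by linarith
  have h12 : 0 < C - (z₁ + z₂) := by linarith
  rw [div_add_div _ _ h1.ne' h2.ne', div_add_div _ _ hC.ne' h12.ne',
    div_le_div_iff₀ (mul_pos h1 h2) (mul_pos hC h12)]
  nlinarith [mul_nonneg (mul_nonneg hz₁ hz₂) (show (0 : ℝ) ≤ 2 * C - z₁ - z₂ by linarith)]

/-- Four-term consequence: `Σ_{i<4} 1/(C − z_i) ≤ 3/C + 1/(C − Σ z_i)`. -/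
theorem inv_sub_sum_four {C z₀ z₁ z₂ z₃ : ℝ} (h₀ : 0 ≤ z₀) (h₁ : 0 ≤ z₁) (h₂ : 0 ≤ z₂) (h₃ : 0 ≤ z₃)
    (h : z₀ + z₁ + z₂ + z₃ < C) :
    1 / (C - z₀) + 1 / (C - z₁) + 1 / (C - z₂) + 1 / (C - z₃) ≤
      3 / C + 1 / (C - (z₀ + z₁ + z₂ + z₃)) := by
  have s1 := inv_sub_superadd (C := C) h₀ h₁ (by linarith)
  have s2 := inv_sub_superadd (C := C) (z₁ := z₀ + z₁) (z₂ := z₂) (by linarith) h₂ (by linarith)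
  have s3 := inv_sub_superadd (C := C) (z₁ := z₀ + z₁ + z₂) (z₂ := z₃) (by linarith) h₃ (by linarith)
  have hC : 0 < C := by linarith
  have e4 : (3 : ℝ) / C = 1 / C + 1 / C + 1 / C := by ring
  rw [e4]
  linarith

/-- The shifted squared norms: `Σ_ν (x + e_μ)_ν² = Σ_ν x_ν² + 2 x_μ + 1`. -/
theorem sum_sq_add_single (x : Fin 4 → ℤ) (μ : Fin 4) :
    ∑ ν, (((x + Pi.single μ 1 : Fin 4 → ℤ) ν : ℤ) : ℝ) ^ 2 =
      ∑ ν, ((x ν : ℤ) : ℝ) ^ 2 + 2 * ((x μ : ℤ) : ℝ) + 1 := by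
  have h1 : ∀ ν, (((x + Pi.single μ 1 : Fin 4 → ℤ) ν : ℤ) : ℝ) =
      ((x ν : ℤ) : ℝ) + if ν = μ then 1 else 0 := by
    intro ν
    by_cases h : ν = μ
    · subst h; simp
    · simp [h]
  simp_rw [h1]
  simp only [add_sq, Finset.sum_add_distrib, mul_ite, mul_one, mul_zero, ite_pow, one_pow,
    zero_pow (two_ne_zero), Finset.sum_ite_eq', Finset.mem_univ, if_true]

/-- The shifted squared norms: `Σ_ν (x − e_μ)_ν² = Σ_ν x_ν² − 2 x_μ + 1`. -/
theorem sum_sq_sub_single (x : Fin 4 → ℤ) (μ : Fin 4) :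
    ∑ ν, (((x - Pi.single μ 1 : Fin 4 → ℤ) ν : ℤ) : ℝ) ^ 2 =
      ∑ ν, ((x ν : ℤ) : ℝ) ^ 2 - 2 * ((x μ : ℤ) : ℝ) + 1 := by
  have h1 : ∀ ν, (((x - Pi.single μ 1 : Fin 4 → ℤ) ν : ℤ) : ℝ) =
      ((x ν : ℤ) : ℝ) - if ν = μ then 1 else 0 := by
    intro ν
    by_cases h : ν = μ
    · subst h; simp
    · simp [h]
  simp_rw [h1]
  simp only [sub_sq, Finset.sum_add_distrib, Finset.sum_sub_distrib, mul_ite, mul_one, mul_zero, ite_pow,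
    one_pow, zero_pow (two_ne_zero), Finset.sum_ite_eq', Finset.mem_univ, if_true]

/-- **The first lemma, PROVED**: the bubble `u_a = 1/(a + |x|²)` is discretely superharmonic on `ℤ⁴` for `a ≥ 2`. -/
theorem bubbleSuperharmonic_holds : BubbleSuperharmonic := by
  intro a ha x
  have hS0 : 0 ≤ ∑ ν, ((x ν : ℤ) : ℝ) ^ 2 := Finset.sum_nonneg fun _ _ => by positivity
  set S : ℝ := ∑ ν, ((x ν : ℤ) : ℝ) ^ 2 with hS
  have hq0 : 0 < a + S := by linarith
  have hx2 : ∀ μ, ((x μ : ℤ) : ℝ) ^ 2 ≤ S := by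
    intro μ
    rw [hS]
    exact Finset.single_le_sum (f := fun ν => ((x ν : ℤ) : ℝ) ^ 2) (fun _ _ => by positivity)
      (Finset.mem_univ μ)
  have hd1 : ∀ μ, 0 < a + (S + 2 * ((x μ : ℤ) : ℝ) + 1) := fun μ => by
    nlinarith [sq_nonneg (((x μ : ℤ) : ℝ) + 1), hx2 μ, ha]
  have hd2 : ∀ μ, 0 < a + (S - 2 * ((x μ : ℤ) : ℝ) + 1) := fun μ => by
    nlinarith [sq_nonneg (((x μ : ℤ) : ℝ) - 1), hx2 μ, ha]
  have hd3 : ∀ μ, 0 < (a + S + 1) ^ 2 - 4 * ((x μ : ℤ) : ℝ) ^ 2 := fun μ => by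
    have : (a + S + 1) ^ 2 - 4 * ((x μ : ℤ) : ℝ) ^ 2 =
        (a + (S + 2 * ((x μ : ℤ) : ℝ) + 1)) * (a + (S - 2 * ((x μ : ℤ) : ℝ) + 1)) := by ring
    rw [this]; exact mul_pos (hd1 μ) (hd2 μ)
  -- each directional second difference in closed form
  have hterm : ∀ μ, 2 * bubbleZ a x - bubbleZ a (x + Pi.single μ 1) - bubbleZ a (x - Pi.single μ 1)
      = 2 / (a + S) - 2 * (a + S + 1) / ((a + S + 1) ^ 2 - 4 * ((x μ : ℤ) : ℝ) ^ 2) := by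
    intro μ
    simp only [bubbleZ]
    rw [sum_sq_add_single, sum_sq_sub_single, ← hS]
    have h12 : 1 / (a + (S + 2 * ((x μ : ℤ) : ℝ) + 1)) + 1 / (a + (S - 2 * ((x μ : ℤ) : ℝ) + 1)) =
        2 * (a + S + 1) / ((a + S + 1) ^ 2 - 4 * ((x μ : ℤ) : ℝ) ^ 2) := by
      rw [div_add_div _ _ (hd1 μ).ne' (hd2 μ).ne',
        show (a + (S + 2 * ((x μ : ℤ) : ℝ) + 1)) * (a + (S - 2 * ((x μ : ℤ) : ℝ) + 1)) =
          (a + S + 1) ^ 2 - 4 * ((x μ : ℤ) : ℝ) ^ 2 by ring]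
      congr 1
      ring
    have h2q : 2 * (1 / (a + S)) = 2 / (a + S) := by ring
    linarith [h12, h2q]
  rw [Fin.sum_univ_four, hterm 0, hterm 1, hterm 2, hterm 3]
  -- the superadditivity step with C = (a+S+1)^2, z_μ = 4 x_μ^2, Σ z = 4 S
  have hS4 : 4 * ((x 0 : ℤ) : ℝ) ^ 2 + 4 * ((x 1 : ℤ) : ℝ) ^ 2 + 4 * ((x 2 : ℤ) : ℝ) ^ 2 +
      4 * ((x 3 : ℤ) : ℝ) ^ 2 = 4 * S := by
    rw [hS, Fin.sum_univ_four]; ring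
  have hD : 0 < (a + S + 1) ^ 2 - 4 * S := by
    have : (a + S + 1) ^ 2 - 4 * S = (a + S - 1) ^ 2 + 4 * a := by ring
    rw [this]; positivity
  have hlt : 4 * ((x 0 : ℤ) : ℝ) ^ 2 + 4 * ((x 1 : ℤ) : ℝ) ^ 2 + 4 * ((x 2 : ℤ) : ℝ) ^ 2 +
      4 * ((x 3 : ℤ) : ℝ) ^ 2 < (a + S + 1) ^ 2 := by rw [hS4]; linarith
  have hfour := inv_sub_sum_four (C := (a + S + 1) ^ 2)
    (z₀ := 4 * ((x 0 : ℤ) : ℝ) ^ 2) (z₁ := 4 * ((x 1 : ℤ) : ℝ) ^ 2)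
    (z₂ := 4 * ((x 2 : ℤ) : ℝ) ^ 2) (z₃ := 4 * ((x 3 : ℤ) : ℝ) ^ 2)
    (by positivity) (by positivity) (by positivity) (by positivity) hlt
  rw [hS4] at hfour
  have hq1 : (0 : ℝ) ≤ 2 * (a + S + 1) := by linarith
  have hmul := mul_le_mul_of_nonneg_left hfour hq1
  have e : 2 * (a + S + 1) * (1 / ((a + S + 1) ^ 2 - 4 * ((x 0 : ℤ) : ℝ) ^ 2) +
      1 / ((a + S + 1) ^ 2 - 4 * ((x 1 : ℤ) : ℝ) ^ 2) +
      1 / ((a + S + 1) ^ 2 - 4 * ((x 2 : ℤ) : ℝ) ^ 2) +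
      1 / ((a + S + 1) ^ 2 - 4 * ((x 3 : ℤ) : ℝ) ^ 2)) =
      2 * (a + S + 1) / ((a + S + 1) ^ 2 - 4 * ((x 0 : ℤ) : ℝ) ^ 2) +
      2 * (a + S + 1) / ((a + S + 1) ^ 2 - 4 * ((x 1 : ℤ) : ℝ) ^ 2) +
      2 * (a + S + 1) / ((a + S + 1) ^ 2 - 4 * ((x 2 : ℤ) : ℝ) ^ 2) +
      2 * (a + S + 1) / ((a + S + 1) ^ 2 - 4 * ((x 3 : ℤ) : ℝ) ^ 2) := by ring
  -- the final one-variable inequality: 8/q − 2(q+1)(3/(q+1)² + 1/D) = ((8a−16)q + 8 + 32a)/(q (q+1) D) ≥ 0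
  have hfinal : 0 ≤ 4 * (2 / (a + S)) -
      2 * (a + S + 1) * (3 / (a + S + 1) ^ 2 + 1 / ((a + S + 1) ^ 2 - 4 * S)) := by
    have hq1' : (0 : ℝ) < a + S + 1 := by linarith
    have key : 4 * (2 / (a + S)) -
        2 * (a + S + 1) * (3 / (a + S + 1) ^ 2 + 1 / ((a + S + 1) ^ 2 - 4 * S)) =
        ((8 * a - 16) * (a + S) + 8 + 32 * a) / ((a + S) * (a + S + 1) * ((a + S + 1) ^ 2 - 4 * S)) := by
      field_simp
      ring
    rw [key]
    apply div_nonneg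
    · nlinarith
    · positivity
  linarith [hmul, e, hfinal]

end BubbleProof


/-! ## Proof of the torus barrier `BubbleBarrierTorus` (hence `GreenKernelBound` is a THEOREM) -/

section TorusBarrierProof

variable {L : ℕ} [NeZero L]

/-- Near the origin the centred representative moves with the shift: `valMinAbs (a+1) = valMinAbs a + 1`. -/
theorem valMinAbs_add_one_of_small (hL : 16 ≤ L) (a : ZMod L)
    (h1 : -(L : ℤ) ≤ 4 * a.valMinAbs) (h2 : 4 * a.valMinAbs ≤ L) :
    (a + 1).valMinAbs = a.valMinAbs + 1 := by
  rw [ZMod.valMinAbs_spec]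
  refine ⟨?_, ?_⟩
  · push_cast
    simp
  · have hL' : (16 : ℤ) ≤ L := by exact_mod_cast hL
    simp only [Set.mem_Ioc]
    constructor <;> linarith

/-- Near the origin: `valMinAbs (a−1) = valMinAbs a − 1`. -/
theorem valMinAbs_sub_one_of_small (hL : 16 ≤ L) (a : ZMod L)
    (h1 : -(L : ℤ) ≤ 4 * a.valMinAbs) (h2 : 4 * a.valMinAbs ≤ L) :
    (a - 1).valMinAbs = a.valMinAbs - 1 := by
  rw [ZMod.valMinAbs_spec]
  refine ⟨?_, ?_⟩
  · push_cast
    simp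
  · have hL' : (16 : ℤ) ≤ L := by exact_mod_cast hL
    simp only [Set.mem_Ioc]
    constructor <;> linarith

omit [NeZero L] in
/-- `(1 : ZMod L).valMinAbs = 1` for `L ≥ 16` (any `L ≥ 3` would do). -/
theorem valMinAbs_one_eq (hL : 16 ≤ L) : (1 : ZMod L).valMinAbs = 1 := by
  have h : ((1 : ℕ) : ZMod L).valMinAbs = (1 : ℕ) := ZMod.valMinAbs_natCast_of_le_half (by omega)
  simpa using h

omit [NeZero L] in
/-- A unit step changes the size of the centred representative by at most one (forward). -/
theorem natAbs_valMinAbs_le_add_one (hL : 16 ≤ L) (a : ZMod L) :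
    a.valMinAbs.natAbs ≤ (a + 1).valMinAbs.natAbs + 1 := by
  have h := ZMod.natAbs_valMinAbs_add_le (a + 1) (-1 : ZMod L)
  have e : a + 1 + -1 = a := by ring
  rw [e] at h
  have h1 : (-1 : ZMod L).valMinAbs.natAbs = 1 := by
    rw [ZMod.natAbs_valMinAbs_neg, valMinAbs_one_eq hL]
    rfl
  calc a.valMinAbs.natAbs ≤ ((a + 1).valMinAbs + (-1 : ZMod L).valMinAbs).natAbs := h
    _ ≤ (a + 1).valMinAbs.natAbs + (-1 : ZMod L).valMinAbs.natAbs := Int.natAbs_add_le _ _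
    _ = (a + 1).valMinAbs.natAbs + 1 := by rw [h1]

omit [NeZero L] in
/-- A unit step changes the size of the centred representative by at most one (backward). -/
theorem natAbs_valMinAbs_le_sub_one (hL : 16 ≤ L) (a : ZMod L) :
    a.valMinAbs.natAbs ≤ (a - 1).valMinAbs.natAbs + 1 := by
  have h := ZMod.natAbs_valMinAbs_add_le (a - 1) (1 : ZMod L)
  have e : a - 1 + 1 = a := by ring
  rw [e] at h
  have h1 : (1 : ZMod L).valMinAbs.natAbs = 1 := by
    rw [valMinAbs_one_eq hL]
    rfl
  calc a.valMinAbs.natAbs ≤ ((a - 1).valMinAbs + (1 : ZMod L).valMinAbs).natAbs := h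
    _ ≤ (a - 1).valMinAbs.natAbs + (1 : ZMod L).valMinAbs.natAbs := Int.natAbs_add_le _ _
    _ = (a - 1).valMinAbs.natAbs + 1 := by rw [h1]

omit [NeZero L] in
/-- The bubble is nonnegative. -/
theorem bubble_nonneg {a : ℝ} (ha : 0 ≤ a) (y : TorusSite 4 L) : 0 ≤ bubble a y := by
  unfold bubble
  positivity

omit [NeZero L] in
/-- One large coordinate makes the bubble small: `c ≤ |valMinAbs y_μ| ⇒ u_3(y) ≤ 1/(3 + c²)`. -/
theorem bubble_le_of_coord (y : TorusSite 4 L) (μ : Fin 4) {c : ℝ} (hc : 0 ≤ c)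
    (h : c ≤ |((ZMod.valMinAbs (y μ) : ℤ) : ℝ)|) : bubble 3 y ≤ 1 / (3 + c ^ 2) := by
  unfold bubble
  have hsum : ((ZMod.valMinAbs (y μ) : ℤ) : ℝ) ^ 2 ≤ ∑ ν, ((ZMod.valMinAbs (y ν) : ℤ) : ℝ) ^ 2 :=
    Finset.single_le_sum (f := fun ν => ((ZMod.valMinAbs (y ν) : ℤ) : ℝ) ^ 2)
      (fun _ _ => by positivity) (Finset.mem_univ μ)
  have hc2 : c ^ 2 ≤ ((ZMod.valMinAbs (y μ) : ℤ) : ℝ) ^ 2 := by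
    calc c ^ 2 ≤ |((ZMod.valMinAbs (y μ) : ℤ) : ℝ)| ^ 2 := pow_le_pow_left₀ hc h 2
      _ = _ := sq_abs _
  apply one_div_le_one_div_of_le (by positivity)
  linarith

omit [NeZero L] in
/-- Adding a constant to the comparison function only adds `m² A` to `K`. -/
theorem massiveLap_const_add (m2 A : ℝ) (b : TorusSite 4 L → ℝ) (x : TorusSite 4 L) :
    massiveLap m2 (fun y => A + b y) x = m2 * A + massiveLap m2 b x := by
  simp only [massiveLap]
  have : ∀ μ : Fin 4, (2 * (A + b x) - (A + b (x + Pi.single μ 1)) - (A + b (x - Pi.single μ 1))) =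
      (2 * b x - b (x + Pi.single μ 1) - b (x - Pi.single μ 1)) := fun μ => by ring
  simp only [this]
  ring

/-- **The torus barrier, PROVED** (with `L₁ = 16`): for `L ≥ 16` and `m² ≥ 1/L`, `ū = 256/(m²L²) + u_3` satisfies
`(K ū)(x) ≥ 0` off the origin and `(K ū)(0) ≥ 2/3`.  Near region (`4|valMinAbs x_μ| ≤ L` for all `μ`): the torus second
differences ARE the `ℤ⁴` ones (`valMinAbs` moves with the shift) and `bubbleSuperharmonic_holds` applies; far region: every
neighbour `y` of `x` has a coordinate with `|valMinAbs y_μ| ≥ L/4 − 1`, so `u_3(y) ≤ 1/(3 + (L/4−1)²) ≤ 32/L²`, and the eight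
of them are paid by `m²·A = 256/L²`. -/
theorem bubbleBarrierTorus_sixteen {L : ℕ} [NeZero L] (hL : 16 ≤ L) (m2 : ℝ) (hm2 : 1 / (L : ℝ) ≤ m2) :
    (∀ x : TorusSite 4 L, x ≠ 0 →
        0 ≤ massiveLap m2 (fun y => 256 / (m2 * (L : ℝ) ^ 2) + bubble 3 y) x) ∧
      2 / 3 ≤ massiveLap m2 (fun y : TorusSite 4 L => 256 / (m2 * (L : ℝ) ^ 2) + bubble 3 y) 0 := by
  have hL16 : (16 : ℝ) ≤ L := by exact_mod_cast hL
  have hLpos : (0 : ℝ) < L := by linarith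
  have hm : 0 < m2 := lt_of_lt_of_le (by positivity) hm2
  have hA : 0 ≤ 256 / (m2 * (L : ℝ) ^ 2) := by positivity
  have hmA : m2 * (256 / (m2 * (L : ℝ) ^ 2)) = 256 / (L : ℝ) ^ 2 := by
    field_simp
  -- the ℤ⁴ shadow of a torus point
  have key_add : ∀ (x : TorusSite 4 L) (μ : Fin 4),
      (∀ κ, -(L : ℤ) ≤ 4 * ZMod.valMinAbs (x κ) ∧ 4 * ZMod.valMinAbs (x κ) ≤ L) →
      ∀ ν, ZMod.valMinAbs ((x + Pi.single μ 1 : TorusSite 4 L) ν) =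
        ((fun κ => ZMod.valMinAbs (x κ)) + Pi.single μ 1 : Fin 4 → ℤ) ν := by
    intro x μ hx ν
    by_cases hν : ν = μ
    · subst hν
      simp only [Pi.add_apply, Pi.single_eq_same]
      exact valMinAbs_add_one_of_small hL (x ν) (hx ν).1 (hx ν).2
    · simp [Pi.add_apply, Pi.single_eq_of_ne hν]
  have key_sub : ∀ (x : TorusSite 4 L) (μ : Fin 4),
      (∀ κ, -(L : ℤ) ≤ 4 * ZMod.valMinAbs (x κ) ∧ 4 * ZMod.valMinAbs (x κ) ≤ L) →
      ∀ ν, ZMod.valMinAbs ((x - Pi.single μ 1 : TorusSite 4 L) ν) =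
        ((fun κ => ZMod.valMinAbs (x κ)) - Pi.single μ 1 : Fin 4 → ℤ) ν := by
    intro x μ hx ν
    by_cases hν : ν = μ
    · subst hν
      simp only [Pi.sub_apply, Pi.single_eq_same]
      exact valMinAbs_sub_one_of_small hL (x ν) (hx ν).1 (hx ν).2
    · simp [Pi.sub_apply, Pi.single_eq_of_ne hν]
  -- NEAR: the second differences of the torus bubble are the ℤ⁴ ones, hence ≥ 0
  have near : ∀ x : TorusSite 4 L,
      (∀ κ, -(L : ℤ) ≤ 4 * ZMod.valMinAbs (x κ) ∧ 4 * ZMod.valMinAbs (x κ) ≤ L) →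
      0 ≤ ∑ μ : Fin 4, (2 * bubble 3 x - bubble 3 (x + Pi.single μ 1) - bubble 3 (x - Pi.single μ 1)) := by
    intro x hx
    have hZ := bubbleSuperharmonic_holds 3 (by norm_num) (fun κ => ZMod.valMinAbs (x κ))
    have e : ∀ μ : Fin 4, 2 * bubble 3 x - bubble 3 (x + Pi.single μ 1) - bubble 3 (x - Pi.single μ 1) =
        2 * bubbleZ 3 (fun κ => ZMod.valMinAbs (x κ)) -
          bubbleZ 3 ((fun κ => ZMod.valMinAbs (x κ)) + Pi.single μ 1) -
          bubbleZ 3 ((fun κ => ZMod.valMinAbs (x κ)) - Pi.single μ 1) := by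
      intro μ
      simp only [bubble, bubbleZ, key_add x μ hx, key_sub x μ hx]
    simp only [e]
    exact hZ
  -- FAR: every neighbour is small
  have far : ∀ (x : TorusSite 4 L) (μ₀ : Fin 4),
      ((L : ℤ) < 4 * ZMod.valMinAbs (x μ₀) ∨ 4 * ZMod.valMinAbs (x μ₀) < -(L : ℤ)) →
      ∀ ν : Fin 4, bubble 3 (x + Pi.single ν 1) ≤ 32 / (L : ℝ) ^ 2 ∧
        bubble 3 (x - Pi.single ν 1) ≤ 32 / (L : ℝ) ^ 2 := by
    intro x μ₀ hfar ν
    -- the coordinate μ₀ of either neighbour has |valMinAbs| ≥ |valMinAbs (x μ₀)| − 1 > L/4 − 1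
    have hbig : (L : ℤ) < 4 * ((ZMod.valMinAbs (x μ₀)).natAbs : ℤ) := by
      rcases hfar with h | h <;> omega
    have step : ∀ r : ℤ, (ZMod.valMinAbs (x μ₀)).natAbs ≤ r.natAbs + 1 →
        (L : ℝ) / 4 - 1 ≤ |(r : ℝ)| := by
      intro r hr
      have h1 : (L : ℤ) < 4 * ((r.natAbs : ℤ) + 1) := by omega
      have h2 : (L : ℝ) < 4 * ((r.natAbs : ℝ) + 1) := by exact_mod_cast h1
      have h3 : ((r.natAbs : ℕ) : ℝ) = |(r : ℝ)| := by rw [Nat.cast_natAbs, Int.cast_abs]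
      rw [← h3]
      linarith
    have hc : (0 : ℝ) ≤ (L : ℝ) / 4 - 1 := by linarith
    have hsq : (32 : ℝ) / (L : ℝ) ^ 2 ≥ 1 / (3 + ((L : ℝ) / 4 - 1) ^ 2) := by
      rw [ge_iff_le, div_le_div_iff₀ (by positivity) (by positivity)]
      nlinarith [sq_nonneg ((L : ℝ) - 8)]
    constructor
    · have hr : (ZMod.valMinAbs (x μ₀)).natAbs ≤ (ZMod.valMinAbs ((x + Pi.single ν 1 : TorusSite 4 L) μ₀)).natAbs + 1 := by
        by_cases hν : μ₀ = ν
        · subst hν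
          simp only [Pi.add_apply, Pi.single_eq_same]
          exact natAbs_valMinAbs_le_add_one hL _
        · simp [Pi.add_apply, Pi.single_eq_of_ne hν]
      exact (bubble_le_of_coord _ μ₀ hc (step _ hr)).trans hsq
    · have hr : (ZMod.valMinAbs (x μ₀)).natAbs ≤ (ZMod.valMinAbs ((x - Pi.single ν 1 : TorusSite 4 L) μ₀)).natAbs + 1 := by
        by_cases hν : μ₀ = ν
        · subst hν
          simp only [Pi.sub_apply, Pi.single_eq_same]
          exact natAbs_valMinAbs_le_sub_one hL _
        · simp [Pi.sub_apply, Pi.single_eq_of_ne hν]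
      exact (bubble_le_of_coord _ μ₀ hc (step _ hr)).trans hsq
  refine ⟨?_, ?_⟩
  · -- off the origin (in fact everywhere): (K ū)(x) ≥ 0
    intro x _
    rw [massiveLap_const_add, hmA]
    simp only [massiveLap]
    have hb0 : 0 ≤ m2 * bubble 3 x := mul_nonneg hm.le (bubble_nonneg (by norm_num) x)
    by_cases hx : ∀ κ, -(L : ℤ) ≤ 4 * ZMod.valMinAbs (x κ) ∧ 4 * ZMod.valMinAbs (x κ) ≤ L
    · have := near x hx
      have : (0 : ℝ) ≤ 256 / (L : ℝ) ^ 2 := by positivity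
      linarith
    · push Not at hx
      obtain ⟨μ₀, hμ₀⟩ := hx
      have hfar : (L : ℤ) < 4 * ZMod.valMinAbs (x μ₀) ∨ 4 * ZMod.valMinAbs (x μ₀) < -(L : ℤ) := by
        by_cases h1 : -(L : ℤ) ≤ 4 * ZMod.valMinAbs (x μ₀)
        · exact Or.inl (hμ₀ h1)
        · exact Or.inr (by linarith)
      have hnb := far x μ₀ hfar
      have hbx : 0 ≤ bubble 3 x := bubble_nonneg (by norm_num) x
      have hsum : -(8 * (32 / (L : ℝ) ^ 2)) ≤
          ∑ μ : Fin 4, (2 * bubble 3 x - bubble 3 (x + Pi.single μ 1) - bubble 3 (x - Pi.single μ 1)) := by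
        have hterm : ∀ μ : Fin 4, -(2 * (32 / (L : ℝ) ^ 2)) ≤
            2 * bubble 3 x - bubble 3 (x + Pi.single μ 1) - bubble 3 (x - Pi.single μ 1) := by
          intro μ
          have h1 := (hnb μ).1
          have h2 := (hnb μ).2
          linarith
        have := Finset.sum_le_sum fun μ (_ : μ ∈ (Finset.univ : Finset (Fin 4))) => hterm μ
        simp only [Finset.sum_const, Finset.card_univ, Fintype.card_fin, nsmul_eq_mul, Nat.cast_ofNat] at this
        linarith
      have : 8 * (32 / (L : ℝ) ^ 2) = 256 / (L : ℝ) ^ 2 := by ring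
      linarith
  · -- at the origin: 2·u(0) − u(e_μ) − u(−e_μ) = 2/3 − 1/4 − 1/4 = 1/6 in each of the four directions
    rw [massiveLap_const_add, hmA]
    simp only [massiveLap]
    have hb0' : bubble 3 (0 : TorusSite 4 L) = 1 / 3 := by simp [bubble]
    have hneg1 : ((ZMod.valMinAbs (-1 : ZMod L) : ℤ) : ℝ) ^ 2 = 1 := by
      have h := ZMod.natAbs_valMinAbs_neg (1 : ZMod L)
      rw [valMinAbs_one_eq hL] at h
      have h2 : (ZMod.valMinAbs (-1 : ZMod L)) ^ 2 = 1 := by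
        rw [← Int.natAbs_sq, h]
        rfl
      exact_mod_cast h2
    have hbp : ∀ μ : Fin 4, bubble 3 ((0 : TorusSite 4 L) + Pi.single μ 1) = 1 / 4 := by
      intro μ
      unfold bubble
      rw [Finset.sum_eq_single μ]
      · simp [valMinAbs_one_eq hL]
        norm_num
      · intro b _ hb
        simp [Pi.single_eq_of_ne hb]
      · intro h
        exact absurd (Finset.mem_univ μ) h
    have hbm : ∀ μ : Fin 4, bubble 3 ((0 : TorusSite 4 L) - Pi.single μ 1) = 1 / 4 := by
      intro μ
      unfold bubble
      rw [Finset.sum_eq_single μ]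
      · simp only [Pi.sub_apply, Pi.zero_apply, Pi.single_eq_same, zero_sub, hneg1]
        norm_num
      · intro b _ hb
        simp [Pi.single_eq_of_ne hb]
      · intro h
        exact absurd (Finset.mem_univ μ) h
    have e : ∀ μ : Fin 4, 2 * bubble 3 (0 : TorusSite 4 L) - bubble 3 ((0 : TorusSite 4 L) + Pi.single μ 1) -
        bubble 3 ((0 : TorusSite 4 L) - Pi.single μ 1) = 1 / 6 := by
      intro μ
      rw [hb0', hbp μ, hbm μ]
      norm_num
    simp only [e, Finset.sum_const, Finset.card_univ, Fintype.card_fin, nsmul_eq_mul, Nat.cast_ofNat]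
    have hb0 : 0 ≤ m2 * bubble 3 (0 : TorusSite 4 L) := mul_nonneg hm.le (bubble_nonneg (by norm_num) 0)
    have : (0 : ℝ) ≤ 256 / (L : ℝ) ^ 2 := by positivity
    linarith

theorem bubbleBarrierTorus_holds : BubbleBarrierTorus :=
  ⟨16, fun L _ hL m2 hm2 => bubbleBarrierTorus_sixteen (L := L) hL m2 hm2⟩

/-- Hence the pointwise two-sided Green kernel bound is a THEOREM. -/
theorem greenKernelBound_holds : GreenKernelBound := greenKernelBound_of_barrier bubbleBarrierTorus_holds

end TorusBarrierProof


/-! ## Towards `SpreadBarrier`: linear algebra of `K = m² − Δ` on the torus -/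

section SpreadProof

variable {L : ℕ} [NeZero L]

omit [NeZero L] in
theorem massiveLap_add (m2 : ℝ) (v w : TorusSite 4 L → ℝ) (x : TorusSite 4 L) :
    massiveLap m2 (v + w) x = massiveLap m2 v x + massiveLap m2 w x := by
  simp only [massiveLap, Pi.add_apply]
  have : ∀ μ : Fin 4, (2 * (v x + w x) - (v (x + Pi.single μ 1) + w (x + Pi.single μ 1)) -
      (v (x - Pi.single μ 1) + w (x - Pi.single μ 1))) =
      (2 * v x - v (x + Pi.single μ 1) - v (x - Pi.single μ 1)) +
        (2 * w x - w (x + Pi.single μ 1) - w (x - Pi.single μ 1)) := fun μ => by ring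
  simp only [this, Finset.sum_add_distrib]
  ring

omit [NeZero L] in
theorem massiveLap_smul (m2 c : ℝ) (v : TorusSite 4 L → ℝ) (x : TorusSite 4 L) :
    massiveLap m2 (c • v) x = c * massiveLap m2 v x := by
  simp only [massiveLap, Pi.smul_apply, smul_eq_mul]
  have : ∀ μ : Fin 4, (2 * (c * v x) - c * v (x + Pi.single μ 1) - c * v (x - Pi.single μ 1)) =
      c * (2 * v x - v (x + Pi.single μ 1) - v (x - Pi.single μ 1)) := fun μ => by ring
  simp only [this, ← Finset.mul_sum]
  ring

omit [NeZero L] in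
theorem massiveLap_sub (m2 : ℝ) (v w : TorusSite 4 L → ℝ) (x : TorusSite 4 L) :
    massiveLap m2 (v - w) x = massiveLap m2 v x - massiveLap m2 w x := by
  have h := massiveLap_smul_sub m2 1 v w x
  simp only [one_mul] at h
  rw [← h]
  rfl

omit [NeZero L] in
theorem massiveLap_zero (m2 : ℝ) (x : TorusSite 4 L) : massiveLap m2 (0 : TorusSite 4 L → ℝ) x = 0 := by
  simp [massiveLap]

omit [NeZero L] in
/-- `K` commutes with finite sums of functions. -/
theorem massiveLap_finset_sum {ι : Type*} (m2 : ℝ) (s : Finset ι) (v : ι → TorusSite 4 L → ℝ)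
    (x : TorusSite 4 L) :
    massiveLap m2 (fun y => ∑ i ∈ s, v i y) x = ∑ i ∈ s, massiveLap m2 (v i) x := by
  classical
  induction s using Finset.induction_on with
  | empty => simp [massiveLap]
  | insert a s ha ih =>
    rw [Finset.sum_insert ha]
    have hfun : (fun y => ∑ i ∈ insert a s, v i y) = v a + fun y => ∑ i ∈ s, v i y := by
      funext y
      rw [Finset.sum_insert ha]
      rfl
    rw [hfun, massiveLap_add, ih]

omit [NeZero L] in
/-- `K` is translation invariant. -/
theorem massiveLap_translate (m2 : ℝ) (u : TorusSite 4 L → ℝ) (y x : TorusSite 4 L) :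
    massiveLap m2 (fun z => u (z - y)) x = massiveLap m2 u (x - y) := by
  simp only [massiveLap]
  congr 1
  refine Finset.sum_congr rfl fun μ _ => ?_
  rw [show x + Pi.single μ 1 - y = x - y + Pi.single μ 1 by abel,
    show x - Pi.single μ 1 - y = x - y - Pi.single μ 1 by abel]

/-- `K` as a linear endomorphism of the function space. -/
def Kmap (m2 : ℝ) : (TorusSite 4 L → ℝ) →ₗ[ℝ] (TorusSite 4 L → ℝ) where
  toFun v := fun x => massiveLap m2 v x
  map_add' v w := funext fun x => massiveLap_add m2 v w x
  map_smul' c v := funext fun x => by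
    simp only [RingHom.id_apply, Pi.smul_apply, smul_eq_mul]
    exact massiveLap_smul m2 c v x

/-- **Unique solvability**: for `m² > 0`, `K g = h` has a solution (injective by the minimum principle, hence
surjective on the finite-dimensional function space). -/
theorem exists_solution (m2 : ℝ) (hm : 0 < m2) (h : TorusSite 4 L → ℝ) :
    ∃ g : TorusSite 4 L → ℝ, ∀ x, massiveLap m2 g x = h x := by
  have hinj : Function.Injective (Kmap (L := L) m2) := by
    intro v w hvw
    have hK : ∀ x, massiveLap m2 v x = massiveLap m2 w x := fun x => congr_fun hvw x
    have h1 : ∀ x, 0 ≤ (v - w) x :=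
      torus_minimum_principle m2 hm _ fun x => by rw [massiveLap_sub, hK x, sub_self]
    have h2 : ∀ x, 0 ≤ (w - v) x :=
      torus_minimum_principle m2 hm _ fun x => by rw [massiveLap_sub, hK x, sub_self]
    funext x
    have a := h1 x
    have b := h2 x
    simp only [Pi.sub_apply] at a b
    linarith
  have hsurj : Function.Surjective (Kmap (L := L) m2) := LinearMap.injective_iff_surjective.mp hinj
  obtain ⟨g, hg⟩ := hsurj h
  exact ⟨g, fun x => congr_fun hg x⟩

end SpreadProof


/-! ## `SpreadBarrier` PROVED: summation by parts, Cauchy–Schwarz in the `K`-form, comparison, Schur -/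

section SpreadProof2

variable {L : ℕ} [NeZero L]

/-- Summation by parts in one direction on the torus. -/
theorem sbp_dir (f g : TorusSite 4 L → ℝ) (e : TorusSite 4 L) :
    ∑ x, f x * (2 * g x - g (x + e) - g (x - e)) = ∑ x, (f (x + e) - f x) * (g (x + e) - g x) := by
  have r1 : ∑ x, f (x + e) * g (x + e) = ∑ x, f x * g x :=
    Fintype.sum_equiv (Equiv.addRight e) (fun x => f (x + e) * g (x + e)) (fun x => f x * g x)
      (fun x => rfl)
  have r2 : ∑ x, f (x + e) * g x = ∑ x, f x * g (x - e) :=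
    Fintype.sum_equiv (Equiv.addRight e) (fun x => f (x + e) * g x) (fun x => f x * g (x - e))
      (fun x => by simp [Equiv.coe_addRight, add_sub_cancel_right])
  have el : ∑ x, f x * (2 * g x - g (x + e) - g (x - e)) =
      2 * ∑ x, f x * g x - ∑ x, f x * g (x + e) - ∑ x, f x * g (x - e) := by
    rw [Finset.mul_sum, ← Finset.sum_sub_distrib, ← Finset.sum_sub_distrib]
    exact Finset.sum_congr rfl fun x _ => by ring
  have er : ∑ x, (f (x + e) - f x) * (g (x + e) - g x) =
      ∑ x, f (x + e) * g (x + e) - ∑ x, f (x + e) * g x - ∑ x, f x * g (x + e) + ∑ x, f x * g x := by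
    rw [← Finset.sum_sub_distrib, ← Finset.sum_sub_distrib, ← Finset.sum_add_distrib]
    exact Finset.sum_congr rfl fun x _ => by ring
  rw [el, er, r1, r2]
  ring

/-- **Summation by parts**: `⟨f, K g⟩ = m² ⟨f, g⟩ + Σ_{x,μ} ∇_μ f · ∇_μ g`. -/
theorem sum_mul_massiveLap (m2 : ℝ) (f g : TorusSite 4 L → ℝ) :
    ∑ x, f x * massiveLap m2 g x =
      m2 * ∑ x, f x * g x +
        ∑ x, ∑ μ : Fin 4, (f (x + Pi.single μ 1) - f x) * (g (x + Pi.single μ 1) - g x) := by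
  simp only [massiveLap, mul_add, Finset.sum_add_distrib, Finset.mul_sum]
  congr 1
  · exact Finset.sum_congr rfl fun x _ => by ring
  · rw [Finset.sum_comm]
    conv_rhs => rw [Finset.sum_comm]
    refine Finset.sum_congr rfl fun μ _ => ?_
    exact sbp_dir f g (Pi.single μ 1)

/-- The `K`-form. -/
def Qform (m2 : ℝ) (f g : TorusSite 4 L → ℝ) : ℝ :=
  m2 * ∑ x, f x * g x + ∑ x, ∑ μ : Fin 4, (f (x + Pi.single μ 1) - f x) * (g (x + Pi.single μ 1) - g x)

/-- **Cauchy–Schwarz in the `K`-form** (`m² ≥ 0`): `Q(f,g)² ≤ Q(f,f) Q(g,g)`, by concatenating `√m²·f` with the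
gradient of `f` into one vector and using the finite Cauchy–Schwarz inequality. -/
theorem Qform_cauchy_schwarz (m2 : ℝ) (hm : 0 ≤ m2) (f g : TorusSite 4 L → ℝ) :
    Qform m2 f g ^ 2 ≤ Qform m2 f f * Qform m2 g g := by
  let a : TorusSite 4 L ⊕ (TorusSite 4 L × Fin 4) → ℝ := fun i =>
    match i with
    | Sum.inl x => Real.sqrt m2 * f x
    | Sum.inr (x, μ) => f (x + Pi.single μ 1) - f x
  let b : TorusSite 4 L ⊕ (TorusSite 4 L × Fin 4) → ℝ := fun i =>
    match i with
    | Sum.inl x => Real.sqrt m2 * g x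
    | Sum.inr (x, μ) => g (x + Pi.single μ 1) - g x
  have hsq : Real.sqrt m2 * Real.sqrt m2 = m2 := Real.mul_self_sqrt hm
  have hab : ∑ i, a i * b i = Qform m2 f g := by
    simp only [Fintype.sum_sum_type, Fintype.sum_prod_type, Qform, a, b]
    congr 1
    rw [Finset.mul_sum]
    exact Finset.sum_congr rfl fun x _ => by linear_combination (f x * g x) * hsq
  have haa : ∑ i, a i ^ 2 = Qform m2 f f := by
    simp only [Fintype.sum_sum_type, Fintype.sum_prod_type, Qform, a]
    congr 1
    · rw [Finset.mul_sum]
      exact Finset.sum_congr rfl fun x _ => by linear_combination (f x * f x) * hsq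
    · exact Finset.sum_congr rfl fun x _ => Finset.sum_congr rfl fun μ _ => by ring
  have hbb : ∑ i, b i ^ 2 = Qform m2 g g := by
    simp only [Fintype.sum_sum_type, Fintype.sum_prod_type, Qform, b]
    congr 1
    · rw [Finset.mul_sum]
      exact Finset.sum_congr rfl fun x _ => by linear_combination (g x * g x) * hsq
    · exact Finset.sum_congr rfl fun x _ => Finset.sum_congr rfl fun μ _ => by ring
  have := Finset.sum_mul_sq_le_sq_mul_sq Finset.univ a b
  rw [hab, haa, hbb] at this
  exact this

/-- **Comparison bound for solutions**: if `K g = h` with `h` supported on `S`, `L ≥ 16`, `m² ≥ 1/L`, then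
`|g(x)| ≤ (3/2) Σ_{y∈S} |h(y)| (256/(m²L²) + u_3(x − y))` — the minimum principle against translates of the PROVED
torus barrier. -/
theorem solution_abs_le (hL : 16 ≤ L) (m2 : ℝ) (hm2 : 1 / (L : ℝ) ≤ m2) (h g : TorusSite 4 L → ℝ)
    (S : Finset (TorusSite 4 L)) (hsupp : ∀ x, x ∉ S → h x = 0) (hg : ∀ x, massiveLap m2 g x = h x) :
    ∀ x, |g x| ≤ (3 / 2) * ∑ y ∈ S, |h y| * (256 / (m2 * (L : ℝ) ^ 2) + bubble 3 (x - y)) := by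
  classical
  have hLpos : (0 : ℝ) < L := by
    have : (16 : ℝ) ≤ L := by exact_mod_cast hL
    linarith
  have hm : 0 < m2 := lt_of_lt_of_le (by positivity) hm2
  -- the barrier ū and its K-image
  set ū : TorusSite 4 L → ℝ := fun y => 256 / (m2 * (L : ℝ) ^ 2) + bubble 3 y with hū
  have hKū : ∀ z : TorusSite 4 L, 0 ≤ massiveLap m2 ū z ∧ (z = 0 → 2 / 3 ≤ massiveLap m2 ū z) := by
    intro z
    have key := bubbleBarrierTorus_sixteen (L := L) hL m2 hm2
    refine ⟨?_, fun hz => ?_⟩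
    · by_cases hz : z = 0
      · subst hz; linarith [key.2]
      · exact key.1 z hz
    · subst hz; exact key.2
  -- the comparison function
  set w : TorusSite 4 L → ℝ := fun x => (3 / 2) * ∑ y ∈ S, |h y| * ū (x - y) with hw
  have hKw : ∀ x, |h x| ≤ massiveLap m2 w x := by
    intro x
    have hlin : massiveLap m2 w x = (3 / 2) * ∑ y ∈ S, |h y| * massiveLap m2 ū (x - y) := by
      have e1 : w = (3 / 2 : ℝ) • fun x => ∑ y ∈ S, (fun y' z => |h y'| * ū (z - y')) y x := by
        funext z
        simp only [hw, Pi.smul_apply, smul_eq_mul]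
      rw [e1, massiveLap_smul, massiveLap_finset_sum]
      congr 1
      refine Finset.sum_congr rfl fun y _ => ?_
      have e2 : (fun z => |h y| * ū (z - y)) = |h y| • fun z => ū (z - y) := by
        funext z; simp only [Pi.smul_apply, smul_eq_mul]
      rw [e2, massiveLap_smul, massiveLap_translate]
    rw [hlin]
    by_cases hx : x ∈ S
    · have hterm : ∀ y ∈ S, 0 ≤ |h y| * massiveLap m2 ū (x - y) :=
        fun y _ => mul_nonneg (abs_nonneg _) (hKū (x - y)).1
      have hsingle : |h x| * massiveLap m2 ū (x - x) ≤ ∑ y ∈ S, |h y| * massiveLap m2 ū (x - y) :=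
        Finset.single_le_sum hterm hx
      have h0 : 2 / 3 ≤ massiveLap m2 ū (x - x) := (hKū (x - x)).2 (sub_self x)
      have : |h x| * (2 / 3) ≤ |h x| * massiveLap m2 ū (x - x) :=
        mul_le_mul_of_nonneg_left h0 (abs_nonneg _)
      nlinarith [abs_nonneg (h x)]
    · rw [hsupp x hx, abs_zero]
      exact mul_nonneg (by norm_num) (Finset.sum_nonneg fun y _ =>
        mul_nonneg (abs_nonneg _) (hKū (x - y)).1)
  -- minimum principle on w − g and w + g
  have h1 : ∀ x, 0 ≤ (w - g) x :=
    torus_minimum_principle m2 hm _ fun x => by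
      rw [massiveLap_sub, hg x]
      linarith [hKw x, le_abs_self (h x)]
  have h2 : ∀ x, 0 ≤ (w + g) x :=
    torus_minimum_principle m2 hm _ fun x => by
      rw [massiveLap_add, hg x]
      linarith [hKw x, neg_abs_le (h x)]
  intro x
  have a := h1 x
  have b := h2 x
  simp only [Pi.sub_apply, Pi.add_apply] at a b
  have hwx : w x = (3 / 2) * ∑ y ∈ S, |h y| * (256 / (m2 * (L : ℝ) ^ 2) + bubble 3 (x - y)) := by
    simp only [hw, hū]
  rw [abs_le, ← hwx]
  constructor <;> linarith

end SpreadProof2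


section SpreadProof3

variable {L : ℕ} [NeZero L]

theorem Qform_self_nonneg (m2 : ℝ) (hm : 0 ≤ m2) (f : TorusSite 4 L → ℝ) : 0 ≤ Qform m2 f f := by
  unfold Qform
  apply add_nonneg
  · exact mul_nonneg hm (Finset.sum_nonneg fun x _ => mul_self_nonneg (f x))
  · exact Finset.sum_nonneg fun x _ => Finset.sum_nonneg fun μ _ => mul_self_nonneg _

/-- **`SpreadBarrier` PROVED** (`L₁ = 16`): box mass is controlled by `(m²‖f‖² + E(f)) · (3/2)|S|(256/L + 1/3)`,
`m² = 1/L` — duality in the `K`-form against the solution of `K g = 1_S f`, the comparison bound `solution_abs_le`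
(minimum principle + the PROVED torus barrier) and Cauchy–Schwarz on `S`. -/
theorem spreadBarrier_holds : SpreadBarrier := by
  classical
  refine ⟨16, ?_⟩
  intro L _ hL f S
  have hL16 : (16 : ℝ) ≤ L := by exact_mod_cast hL
  have hLpos : (0 : ℝ) < L := by linarith
  set m2 : ℝ := 1 / (L : ℝ) with hm2def
  have hm2 : 1 / (L : ℝ) ≤ m2 := le_rfl
  have hm : 0 < m2 := by positivity
  -- right-hand side `h = 1_S f` and a solution `g` of `K g = h`
  set h : TorusSite 4 L → ℝ := fun x => if x ∈ S then f x else 0 with hh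
  have hsupp : ∀ x, x ∉ S → h x = 0 := fun x hx => by simp [hh, hx]
  obtain ⟨g, hg⟩ := exists_solution m2 hm h
  set mS : ℝ := ∑ x ∈ S, f x ^ 2 with hmS
  -- m_S = ⟨f, h⟩ = ⟨f, K g⟩ = Q(f, g)
  have hfh : ∑ x, f x * h x = mS := by
    simp only [hmS, hh, mul_ite, mul_zero, Finset.sum_ite_mem, Finset.univ_inter]
    exact Finset.sum_congr rfl fun x _ => by ring
  have hQfg : Qform m2 f g = mS := by
    have e := sum_mul_massiveLap m2 f g
    simp only [hg] at e
    rw [hfh] at e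
    unfold Qform
    exact e.symm
  -- Q(g, g) = ⟨g, h⟩
  have hQgg : Qform m2 g g = ∑ x, g x * h x := by
    have e := sum_mul_massiveLap m2 g g
    simp only [hg] at e
    unfold Qform
    exact e.symm
  -- the Schur-type bound ⟨g, h⟩ ≤ (3/2)|S|(A + 1/3) m_S
  set A : ℝ := 256 / (m2 * (L : ℝ) ^ 2) with hA
  have hA' : A = 256 / (L : ℝ) := by
    rw [hA, hm2def]
    field_simp
  have hB : ∀ z : TorusSite 4 L, A + bubble 3 z ≤ A + 1 / 3 := fun z => by
    have hb : bubble 3 z ≤ 1 / 3 := by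
      unfold bubble
      apply one_div_le_one_div_of_le (by norm_num)
      have : 0 ≤ ∑ ν, ((ZMod.valMinAbs (z ν) : ℤ) : ℝ) ^ 2 :=
        Finset.sum_nonneg fun _ _ => by positivity
      linarith
    linarith
  have habs := solution_abs_le hL m2 hm2 h g S hsupp hg
  have hgh : ∑ x, g x * h x ≤ (3 / 2) * S.card * (A + 1 / 3) * mS := by
    have e1 : ∑ x, g x * h x = ∑ x ∈ S, g x * f x := by
      simp only [hh, mul_ite, mul_zero, Finset.sum_ite_mem, Finset.univ_inter]
    rw [e1]
    have e2 : ∀ y ∈ S, |h y| = |f y| := fun y hy => by simp [hh, hy]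
    have step1 : ∑ x ∈ S, g x * f x ≤
        ∑ x ∈ S, |f x| * ((3 / 2) * ∑ y ∈ S, |f y| * (A + 1 / 3)) := by
      apply Finset.sum_le_sum
      intro x hx
      have h1 : g x * f x ≤ |g x| * |f x| := by
        rw [← abs_mul]
        exact le_abs_self _
      have h2 : |g x| ≤ (3 / 2) * ∑ y ∈ S, |f y| * (A + 1 / 3) := by
        refine (habs x).trans ?_
        apply mul_le_mul_of_nonneg_left _ (by norm_num)
        apply Finset.sum_le_sum
        intro y hy
        rw [e2 y hy]
        exact mul_le_mul_of_nonneg_left (hB _) (abs_nonneg _)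
      calc g x * f x ≤ |g x| * |f x| := h1
        _ ≤ ((3 / 2) * ∑ y ∈ S, |f y| * (A + 1 / 3)) * |f x| :=
            mul_le_mul_of_nonneg_right h2 (abs_nonneg _)
        _ = |f x| * ((3 / 2) * ∑ y ∈ S, |f y| * (A + 1 / 3)) := by ring
    have step2 : ∑ x ∈ S, |f x| * ((3 / 2) * ∑ y ∈ S, |f y| * (A + 1 / 3)) =
        (3 / 2) * (A + 1 / 3) * (∑ x ∈ S, |f x|) ^ 2 := by
      rw [← Finset.sum_mul, ← Finset.sum_mul]
      ring
    have step3 : (∑ x ∈ S, |f x|) ^ 2 ≤ S.card * mS := by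
      have cs := Finset.sum_mul_sq_le_sq_mul_sq S (fun x => |f x|) (fun _ => (1 : ℝ))
      simp only [mul_one, one_pow, Finset.sum_const, nsmul_eq_mul, sq_abs] at cs
      rw [hmS]
      linarith [mul_comm (∑ x ∈ S, f x ^ 2) (S.card : ℝ)]
    have hcoef : 0 ≤ (3 / 2) * (A + 1 / 3) := by positivity
    calc ∑ x ∈ S, g x * f x ≤ (3 / 2) * (A + 1 / 3) * (∑ x ∈ S, |f x|) ^ 2 := by rw [← step2]; exact step1
      _ ≤ (3 / 2) * (A + 1 / 3) * (S.card * mS) := mul_le_mul_of_nonneg_left step3 hcoef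
      _ = (3 / 2) * S.card * (A + 1 / 3) * mS := by ring
  -- Cauchy–Schwarz in the K-form and division by m_S
  have hCS := Qform_cauchy_schwarz m2 hm.le f g
  rw [hQfg, hQgg] at hCS
  have hQff0 : 0 ≤ Qform m2 f f := Qform_self_nonneg m2 hm.le f
  have hQff : Qform m2 f f =
      m2 * ∑ y, f y ^ 2 + ∑ y, ∑ μ, (f (QuantumFieldTheory.Site.shift y μ) - f y) ^ 2 := by
    simp only [Qform, pow_two]
    rfl
  have hC : (3 / 2 : ℝ) * S.card * (256 / (L : ℝ) + 1 / 3) = (3 / 2) * S.card * (A + 1 / 3) := by rw [hA']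
  rw [← hQff, hC]
  have hmS0 : 0 ≤ mS := by rw [hmS]; exact Finset.sum_nonneg fun x _ => by positivity
  have hC0 : 0 ≤ (3 / 2 : ℝ) * S.card * (A + 1 / 3) := by positivity
  rcases hmS0.lt_or_eq with hpos | hzero
  · -- m_S > 0: m_S² ≤ Q(f,f) · C · m_S
    have key : mS * mS ≤ (Qform m2 f f * ((3 / 2) * S.card * (A + 1 / 3))) * mS := by
      calc mS * mS = mS ^ 2 := by ring
        _ ≤ Qform m2 f f * ∑ x, g x * h x := hCS
        _ ≤ Qform m2 f f * ((3 / 2) * S.card * (A + 1 / 3) * mS) :=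
            mul_le_mul_of_nonneg_left hgh hQff0
        _ = (Qform m2 f f * ((3 / 2) * S.card * (A + 1 / 3))) * mS := by ring
    exact le_of_mul_le_mul_right key hpos
  · rw [← hzero]
    exact mul_nonneg hQff0 hC0

end SpreadProof3


/-! ## Towards `NoLeakBarrier`: the scalar dual bound (all real algebra; the complex plumbing comes after) -/

section DualBound

variable {L : ℕ} [NeZero L]

/-- **Dual Schur bound**: if `K g = h` with `h` supported on `S` (`L ≥ 16`, `m² ≥ 1/L`), then
`⟨g, h⟩ ≤ (3/2)|S|(256/(m²L²) + 1/3) · Σ_{x∈S} h(x)²`. -/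
theorem dual_schur_bound (hL : 16 ≤ L) (m2 : ℝ) (hm2 : 1 / (L : ℝ) ≤ m2) (h g : TorusSite 4 L → ℝ)
    (S : Finset (TorusSite 4 L)) (hsupp : ∀ x, x ∉ S → h x = 0) (hg : ∀ x, massiveLap m2 g x = h x) :
    ∑ x, g x * h x ≤ (3 / 2) * S.card * (256 / (m2 * (L : ℝ) ^ 2) + 1 / 3) * ∑ x ∈ S, h x ^ 2 := by
  classical
  have hLpos : (0 : ℝ) < L := by
    have : (16 : ℝ) ≤ L := by exact_mod_cast hL
    linarith
  have hm : 0 < m2 := lt_of_lt_of_le (by positivity) hm2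
  set A : ℝ := 256 / (m2 * (L : ℝ) ^ 2) with hA
  have hApos : 0 ≤ A := by positivity
  have hB : ∀ z : TorusSite 4 L, A + bubble 3 z ≤ A + 1 / 3 := fun z => by
    have hb : bubble 3 z ≤ 1 / 3 := by
      unfold bubble
      apply one_div_le_one_div_of_le (by norm_num)
      have : 0 ≤ ∑ ν, ((ZMod.valMinAbs (z ν) : ℤ) : ℝ) ^ 2 :=
        Finset.sum_nonneg fun _ _ => by positivity
      linarith
    linarith
  have habs := solution_abs_le hL m2 hm2 h g S hsupp hg
  have e1 : ∑ x, g x * h x = ∑ x ∈ S, g x * h x := by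
    symm
    apply Finset.sum_subset (Finset.subset_univ S)
    intro x _ hx
    rw [hsupp x hx, mul_zero]
  rw [e1]
  have step1 : ∑ x ∈ S, g x * h x ≤
      ∑ x ∈ S, |h x| * ((3 / 2) * ∑ y ∈ S, |h y| * (A + 1 / 3)) := by
    apply Finset.sum_le_sum
    intro x hx
    have h1 : g x * h x ≤ |g x| * |h x| := by
      rw [← abs_mul]
      exact le_abs_self _
    have h2 : |g x| ≤ (3 / 2) * ∑ y ∈ S, |h y| * (A + 1 / 3) := by
      refine (habs x).trans ?_
      apply mul_le_mul_of_nonneg_left _ (by norm_num)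
      apply Finset.sum_le_sum
      intro y _
      exact mul_le_mul_of_nonneg_left (hB _) (abs_nonneg _)
    calc g x * h x ≤ |g x| * |h x| := h1
      _ ≤ ((3 / 2) * ∑ y ∈ S, |h y| * (A + 1 / 3)) * |h x| :=
          mul_le_mul_of_nonneg_right h2 (abs_nonneg _)
      _ = |h x| * ((3 / 2) * ∑ y ∈ S, |h y| * (A + 1 / 3)) := by ring
  have step2 : ∑ x ∈ S, |h x| * ((3 / 2) * ∑ y ∈ S, |h y| * (A + 1 / 3)) =
      (3 / 2) * (A + 1 / 3) * (∑ x ∈ S, |h x|) ^ 2 := by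
    rw [← Finset.sum_mul, ← Finset.sum_mul]
    ring
  have step3 : (∑ x ∈ S, |h x|) ^ 2 ≤ S.card * ∑ x ∈ S, h x ^ 2 := by
    have cs := Finset.sum_mul_sq_le_sq_mul_sq S (fun x => |h x|) (fun _ => (1 : ℝ))
    simp only [mul_one, one_pow, Finset.sum_const, nsmul_eq_mul, sq_abs] at cs
    linarith [mul_comm (∑ x ∈ S, h x ^ 2) (S.card : ℝ)]
  have hcoef : 0 ≤ (3 / 2) * (A + 1 / 3) := by positivity
  calc ∑ x ∈ S, g x * h x ≤ (3 / 2) * (A + 1 / 3) * (∑ x ∈ S, |h x|) ^ 2 := by rw [← step2]; exact step1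
    _ ≤ (3 / 2) * (A + 1 / 3) * (S.card * ∑ x ∈ S, h x ^ 2) := mul_le_mul_of_nonneg_left step3 hcoef
    _ = (3 / 2) * S.card * (A + 1 / 3) * ∑ x ∈ S, h x ^ 2 := by ring

/-- **Scalar dual bound**: for nonnegative weights `p` supported on `S` and ANY real field `w`,
`Σ_x p(x)|w(x)| ≤ √(C_S Σ_{x∈S} p(x)²) · √(Q_{m²}(w,w))`, `C_S = (3/2)|S|(256/(m²L²) + 1/3)` — duality in the `K`-form
against the solution of `K g = p·sign(w)`. -/
theorem scalar_dual_bound (hL : 16 ≤ L) (m2 : ℝ) (hm2 : 1 / (L : ℝ) ≤ m2) (p w : TorusSite 4 L → ℝ)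
    (S : Finset (TorusSite 4 L)) (hsupp : ∀ x, x ∉ S → p x = 0) (_hp : ∀ x, 0 ≤ p x) :
    ∑ x, p x * |w x| ≤
      Real.sqrt ((3 / 2) * S.card * (256 / (m2 * (L : ℝ) ^ 2) + 1 / 3) * ∑ x ∈ S, p x ^ 2) *
        Real.sqrt (Qform m2 w w) := by
  classical
  have hLpos : (0 : ℝ) < L := by
    have : (16 : ℝ) ≤ L := by exact_mod_cast hL
    linarith
  have hm : 0 < m2 := lt_of_lt_of_le (by positivity) hm2
  -- signed weights
  set q : TorusSite 4 L → ℝ := fun x => if 0 ≤ w x then p x else -p x with hq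
  have hqsupp : ∀ x, x ∉ S → q x = 0 := fun x hx => by simp [hq, hsupp x hx]
  have hqw : ∀ x, q x * w x = p x * |w x| := by
    intro x
    by_cases hw : 0 ≤ w x
    · simp [hq, hw, abs_of_nonneg hw]
    · have hlt : w x < 0 := lt_of_not_ge hw
      simp [hq, hw, abs_of_neg hlt]
  have hq2 : ∀ x, q x ^ 2 = p x ^ 2 := by
    intro x
    by_cases hw : 0 ≤ w x
    · simp [hq, hw]
    · simp [hq, hw]
  obtain ⟨g, hg⟩ := exists_solution m2 hm q
  -- Σ p |w| = Σ q w = ⟨w, K g⟩ = Q(w, g)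
  have e1 : ∑ x, p x * |w x| = Qform m2 w g := by
    have e := sum_mul_massiveLap m2 w g
    simp only [hg] at e
    unfold Qform
    rw [← e]
    exact Finset.sum_congr rfl fun x _ => by rw [← hqw x]; ring
  have hCS := Qform_cauchy_schwarz m2 hm.le w g
  have hQgg : Qform m2 g g = ∑ x, g x * q x := by
    have e := sum_mul_massiveLap m2 g g
    simp only [hg] at e
    unfold Qform
    exact e.symm
  have hdual := dual_schur_bound hL m2 hm2 q g S hqsupp hg
  have hq2S : ∑ x ∈ S, q x ^ 2 = ∑ x ∈ S, p x ^ 2 := Finset.sum_congr rfl fun x _ => hq2 x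
  rw [hq2S] at hdual
  have hQww : 0 ≤ Qform m2 w w := Qform_self_nonneg m2 hm.le w
  have hQgg0 : 0 ≤ Qform m2 g g := Qform_self_nonneg m2 hm.le g
  set C : ℝ := (3 / 2) * S.card * (256 / (m2 * (L : ℝ) ^ 2) + 1 / 3) * ∑ x ∈ S, p x ^ 2 with hC
  have hC0 : 0 ≤ C := by
    rw [hC]
    apply mul_nonneg (by positivity)
    exact Finset.sum_nonneg fun x _ => by positivity
  rw [e1]
  -- Q(w,g)² ≤ Q(w,w) Q(g,g) ≤ Q(w,w) · C
  have hsq : Qform m2 w g ^ 2 ≤ C * Qform m2 w w := by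
    calc Qform m2 w g ^ 2 ≤ Qform m2 w w * Qform m2 g g := hCS
      _ ≤ Qform m2 w w * C := by
          apply mul_le_mul_of_nonneg_left _ hQww
          rw [hQgg]; exact hdual
      _ = C * Qform m2 w w := by ring
  calc Qform m2 w g ≤ |Qform m2 w g| := le_abs_self _
    _ = Real.sqrt (Qform m2 w g ^ 2) := (Real.sqrt_sq_eq_abs _).symm
    _ ≤ Real.sqrt (C * Qform m2 w w) := Real.sqrt_le_sqrt hsq
    _ = Real.sqrt C * Real.sqrt (Qform m2 w w) := Real.sqrt_mul hC0 _

end DualBound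


/-! ## `NoLeakBarrier` from the (adjoint) sum-of-squares inequality: the complex plumbing -/

section ComplexNoLeak

variable {L : ℕ} [NeZero L]

/-- `Re ⟨ψ, ψ⟩ = ‖ψ‖²`. -/
theorem re_star_dotProduct_self {ι : Type*} [Fintype ι] (ψ : ι → ℂ) :
    (star ψ ⬝ᵥ ψ).re = ∑ i, ‖ψ i‖ ^ 2 := by
  rw [dotProduct, Complex.re_sum]
  refine Finset.sum_congr rfl fun i _ => ?_
  rw [Pi.star_apply]
  show ((starRingEnd ℂ) (ψ i) * ψ i).re = ‖ψ i‖ ^ 2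
  rw [← Complex.normSq_eq_conj_mul_self, Complex.ofReal_re, Complex.normSq_eq_norm_sq]

/-- `|Re ⟨φ, v⟩| ≤ Σ ‖φ i‖ ‖v i‖`. -/
theorem re_star_dotProduct_le {ι : Type*} [Fintype ι] (φ v : ι → ℂ) :
    (star φ ⬝ᵥ v).re ≤ ∑ i, ‖φ i‖ * ‖v i‖ := by
  rw [dotProduct, Complex.re_sum]
  refine Finset.sum_le_sum fun i _ => ?_
  calc ((star φ) i * v i).re ≤ ‖(star φ) i * v i‖ := Complex.re_le_norm _
    _ = ‖φ i‖ * ‖v i‖ := by rw [norm_mul, Pi.star_apply, norm_star]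

/-- Sum reindexing: components outside, sites and directions inside ↔ the `HoleDominatesLaplacian` nesting. -/
theorem sum_comp_site_dir (g : TorusSite 4 L → Fin 4 → Fin 3 × Fin 4 → ℝ) :
    ∑ c : Fin 3 × Fin 4, ∑ x, ∑ μ, g x μ c = ∑ x, ∑ μ, ∑ a, ∑ α, g x μ (a, α) := by
  have e1 : ∑ q : TorusSite 4 L × Fin 4, ∑ c : Fin 3 × Fin 4, g q.1 q.2 c =
      ∑ x, ∑ μ, ∑ c : Fin 3 × Fin 4, g x μ c := by
    rw [Fintype.sum_prod_type]
  have e2 : ∑ q : TorusSite 4 L × Fin 4, ∑ c : Fin 3 × Fin 4, g q.1 q.2 c =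
      ∑ c : Fin 3 × Fin 4, ∑ q : TorusSite 4 L × Fin 4, g q.1 q.2 c := Finset.sum_comm
  have e3 : ∀ c, ∑ q : TorusSite 4 L × Fin 4, g q.1 q.2 c = ∑ x, ∑ μ, g x μ c := fun c => by
    rw [Fintype.sum_prod_type]
  have e4 : ∑ x, ∑ μ, ∑ c : Fin 3 × Fin 4, g x μ c = ∑ x, ∑ μ, ∑ a, ∑ α, g x μ (a, α) := by
    simp only [Fintype.sum_prod_type]
  rw [← e4, ← e1, e2]
  exact Finset.sum_congr rfl fun c _ => (e3 c).symm

/-- Sum reindexing: components outside, sites inside ↔ one sum over the index type. -/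
theorem sum_comp_site (g : TorusSite 4 L → Fin 3 × Fin 4 → ℝ) :
    ∑ c : Fin 3 × Fin 4, ∑ x, g x c = ∑ i : TorusSite 4 L × Fin 3 × Fin 4, g i.1 i.2 := by
  rw [Finset.sum_comm]
  symm
  rw [Fintype.sum_prod_type]

set_option maxHeartbeats 1600000 in
/-- **No-leak from the adjoint sum-of-squares inequality, for an ARBITRARY complex matrix `D`.**
If `‖(Dᴴ − t)χ‖² ≥ t²‖χ‖² + (1−t)E(χ)` for all `χ` (the adjoint half of `HoleDominatesLaplacian`), `1/√L ≤ t ≤ 1/4`,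
`L ≥ 16`, and `φ = (D − t)ψ` vanishes off the site set `S`, then `‖ψ‖² ≤ 4|S|(256/L + 1/3)‖φ‖²`.
Mechanism: `‖ψ‖² = Re⟨φ, v⟩` with `(Dᴴ − t)v = ψ` (solvable: `Dᴴ − t` is injective by the hypothesis), then the scalar dual
bound (`scalar_dual_bound`, i.e. the PROVED kernel machinery) on each of the 24 real fields `Re/Im v(·,a,α)`, Cauchy–Schwarz
over the components, and the hypothesis once more to bound the `K`-forms of `v` by `‖ψ‖²/(1−t)`. -/
theorem noLeak_of_adjoint_sos (hL : 16 ≤ L) (t : ℝ) (ht1 : 1 / Real.sqrt (L : ℝ) ≤ t) (ht4 : t ≤ 1 / 4)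
    (D : Matrix (TorusSite 4 L × Fin 3 × Fin 4) (TorusSite 4 L × Fin 3 × Fin 4) ℂ)
    (hSOS : ∀ χ : TorusSite 4 L × Fin 3 × Fin 4 → ℂ,
      t ^ 2 * ∑ i, ‖χ i‖ ^ 2 +
          (1 - t) * ∑ x, ∑ μ, ∑ a, ∑ α,
            ‖χ (QuantumFieldTheory.Site.shift x μ, a, α) - χ (x, a, α)‖ ^ 2 ≤
        ∑ i, ‖(Dᴴ *ᵥ χ - (t : ℂ) • χ) i‖ ^ 2)
    (S : Finset (TorusSite 4 L)) (ψ : TorusSite 4 L × Fin 3 × Fin 4 → ℂ)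
    (hsupp : ∀ i : TorusSite 4 L × Fin 3 × Fin 4, i.1 ∉ S → (D *ᵥ ψ - (t : ℂ) • ψ) i = 0) :
    ∑ i, ‖ψ i‖ ^ 2 ≤ (4 * S.card * (256 / (L : ℝ) + 1 / 3)) * ∑ i, ‖(D *ᵥ ψ - (t : ℂ) • ψ) i‖ ^ 2 := by
  classical
  -- scalars
  have hL16 : (16 : ℝ) ≤ L := by exact_mod_cast hL
  have hLpos : (0 : ℝ) < L := by linarith
  have hsqrtL : 0 < Real.sqrt (L : ℝ) := Real.sqrt_pos.mpr hLpos
  have ht0 : 0 < t := lt_of_lt_of_le (by positivity) ht1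
  have ht1' : 1 / (L : ℝ) ≤ t ^ 2 := by
    have h := pow_le_pow_left₀ (by positivity) ht1 2
    rwa [div_pow, one_pow, Real.sq_sqrt hLpos.le] at h
  have h1t : 0 < 1 - t := by linarith
  have h1t' : 1 - t ≤ 1 := by linarith
  set m2 : ℝ := t ^ 2 / (1 - t) with hm2def
  have hm2t : t ^ 2 ≤ m2 := by
    rw [hm2def, le_div_iff₀ h1t]
    nlinarith [sq_nonneg t]
  have hm2 : 1 / (L : ℝ) ≤ m2 := ht1'.trans hm2t
  have hm2pos : 0 < m2 := lt_of_lt_of_le (by positivity) hm2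
  set φ : TorusSite 4 L × Fin 3 × Fin 4 → ℂ := D *ᵥ ψ - (t : ℂ) • ψ with hφ
  -- (1) solve (Dᴴ − t) v = ψ
  have hinj : Function.Injective (Matrix.toLin' (Dᴴ - (t : ℂ) • (1 : Matrix _ _ ℂ))) := by
    intro v w hvw
    rw [← sub_eq_zero]
    set u := v - w with hu
    have h0 : Dᴴ *ᵥ u - (t : ℂ) • u = 0 := by
      have := congr_arg (fun z => z) hvw
      simp only [Matrix.toLin'_apply] at hvw
      have e : (Dᴴ - (t : ℂ) • (1 : Matrix _ _ ℂ)) *ᵥ u = 0 := by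
        rw [hu, Matrix.mulVec_sub, hvw, sub_self]
      rw [Matrix.sub_mulVec, Matrix.smul_mulVec, Matrix.one_mulVec] at e
      exact e
    have hle := hSOS u
    rw [h0] at hle
    simp only [Pi.zero_apply, norm_zero, ne_eq, OfNat.ofNat_ne_zero, not_false_eq_true, zero_pow,
      Finset.sum_const_zero] at hle
    have hE : 0 ≤ ∑ x, ∑ μ, ∑ a, ∑ α,
        ‖u (QuantumFieldTheory.Site.shift x μ, a, α) - u (x, a, α)‖ ^ 2 :=
      Finset.sum_nonneg fun _ _ => Finset.sum_nonneg fun _ _ => Finset.sum_nonneg fun _ _ =>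
        Finset.sum_nonneg fun _ _ => by positivity
    have hprod : t ^ 2 * ∑ i, ‖u i‖ ^ 2 ≤ 0 := by linarith [mul_nonneg h1t.le hE]
    have hsum : ∑ i, ‖u i‖ ^ 2 ≤ 0 := by
      by_contra hc
      have hc' : 0 < ∑ i, ‖u i‖ ^ 2 := lt_of_not_ge hc
      have := mul_pos (pow_pos ht0 2) hc'
      linarith
    have hsum0 : ∑ i, ‖u i‖ ^ 2 = 0 := le_antisymm hsum (Finset.sum_nonneg fun _ _ => by positivity)
    have hall := (Finset.sum_eq_zero_iff_of_nonneg fun i _ => by positivity).mp hsum0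
    funext i
    have := hall i (Finset.mem_univ i)
    simpa using this
  have hsurj : Function.Surjective (Matrix.toLin' (Dᴴ - (t : ℂ) • (1 : Matrix _ _ ℂ))) :=
    LinearMap.injective_iff_surjective.mp hinj
  obtain ⟨v, hv⟩ := hsurj ψ
  rw [Matrix.toLin'_apply, Matrix.sub_mulVec, Matrix.smul_mulVec, Matrix.one_mulVec] at hv
  -- hv : Dᴴ *ᵥ v - (t:ℂ) • v = ψ
  -- (2) ‖ψ‖² = Re ⟨φ, v⟩
  have ht' : star (t : ℂ) = (t : ℂ) := Complex.conj_ofReal t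
  have hkey : star ψ ⬝ᵥ ψ = star φ ⬝ᵥ v := by
    calc star ψ ⬝ᵥ ψ = star ψ ⬝ᵥ (Dᴴ *ᵥ v - (t : ℂ) • v) := by rw [hv]
      _ = star ψ ⬝ᵥ (Dᴴ *ᵥ v) - (t : ℂ) * (star ψ ⬝ᵥ v) := by
          rw [dotProduct_sub, dotProduct_smul, smul_eq_mul]
      _ = star (D *ᵥ ψ) ⬝ᵥ v - (t : ℂ) * (star ψ ⬝ᵥ v) := by
          rw [Matrix.dotProduct_mulVec, ← Matrix.star_mulVec]
      _ = star φ ⬝ᵥ v := by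
          rw [hφ, star_sub, star_smul, sub_dotProduct, smul_dotProduct, ht', smul_eq_mul]
  have hX : ∑ i, ‖ψ i‖ ^ 2 = (star φ ⬝ᵥ v).re := by
    rw [← hkey, re_star_dotProduct_self]
  -- (3) Re ⟨φ, v⟩ ≤ Σ ‖φ i‖ (|Re v i| + |Im v i|)
  have h3 : (star φ ⬝ᵥ v).re ≤ ∑ i, (‖φ i‖ * |(v i).re| + ‖φ i‖ * |(v i).im|) := by
    refine (re_star_dotProduct_le φ v).trans (Finset.sum_le_sum fun i _ => ?_)
    rw [← mul_add]
    exact mul_le_mul_of_nonneg_left (Complex.norm_le_abs_re_add_abs_im _) (norm_nonneg _)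
  -- components
  set p : Fin 3 × Fin 4 → TorusSite 4 L → ℝ := fun c x => ‖φ (x, c)‖ with hp
  set vre : Fin 3 × Fin 4 → TorusSite 4 L → ℝ := fun c x => (v (x, c)).re with hvre
  set vim : Fin 3 × Fin 4 → TorusSite 4 L → ℝ := fun c x => (v (x, c)).im with hvim
  have hpsupp : ∀ c x, x ∉ S → p c x = 0 := fun c x hx => by
    simp only [hp]
    rw [hsupp (x, c) hx, norm_zero]
  have hp0 : ∀ c x, 0 ≤ p c x := fun c x => norm_nonneg _
  set C : ℝ := (3 / 2) * S.card * (256 / (m2 * (L : ℝ) ^ 2) + 1 / 3) with hC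
  have hC0 : 0 ≤ C := by positivity
  set P : Fin 3 × Fin 4 → ℝ := fun c => ∑ x ∈ S, p c x ^ 2 with hP
  have hP0 : ∀ c, 0 ≤ P c := fun c => Finset.sum_nonneg fun _ _ => by positivity
  -- (4) reorganise the sum of (3) by components and apply the scalar dual bound
  have h4 : ∑ i, (‖φ i‖ * |(v i).re| + ‖φ i‖ * |(v i).im|) =
      ∑ c, (∑ x, p c x * |vre c x| + ∑ x, p c x * |vim c x|) := by
    rw [← sum_comp_site (fun x c => ‖φ (x, c)‖ * |(v (x, c)).re| + ‖φ (x, c)‖ * |(v (x, c)).im|)]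
    refine Finset.sum_congr rfl fun c _ => ?_
    rw [← Finset.sum_add_distrib]
  have h5 : ∀ c, ∑ x, p c x * |vre c x| + ∑ x, p c x * |vim c x| ≤
      Real.sqrt (C * P c) * (Real.sqrt (Qform m2 (vre c) (vre c)) + Real.sqrt (Qform m2 (vim c) (vim c))) := by
    intro c
    have a := scalar_dual_bound hL m2 hm2 (p c) (vre c) S (hpsupp c) (hp0 c)
    have b := scalar_dual_bound hL m2 hm2 (p c) (vim c) S (hpsupp c) (hp0 c)
    rw [mul_add]
    exact add_le_add a b
  -- (5) Cauchy–Schwarz over the components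
  set Qtot : ℝ := ∑ c, (Qform m2 (vre c) (vre c) + Qform m2 (vim c) (vim c)) with hQtot
  have hQ0 : ∀ c, 0 ≤ Qform m2 (vre c) (vre c) := fun c => Qform_self_nonneg m2 hm2pos.le _
  have hQ0' : ∀ c, 0 ≤ Qform m2 (vim c) (vim c) := fun c => Qform_self_nonneg m2 hm2pos.le _
  have hQtot0 : 0 ≤ Qtot := Finset.sum_nonneg fun c _ => add_nonneg (hQ0 c) (hQ0' c)
  have h6 : ∑ c, Real.sqrt (C * P c) *
        (Real.sqrt (Qform m2 (vre c) (vre c)) + Real.sqrt (Qform m2 (vim c) (vim c))) ≤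
      Real.sqrt (C * ∑ c, P c) * Real.sqrt (2 * Qtot) := by
    have cs := Finset.sum_mul_sq_le_sq_mul_sq Finset.univ (fun c => Real.sqrt (C * P c))
      (fun c => Real.sqrt (Qform m2 (vre c) (vre c)) + Real.sqrt (Qform m2 (vim c) (vim c)))
    have ea : ∑ c, Real.sqrt (C * P c) ^ 2 = C * ∑ c, P c := by
      rw [Finset.mul_sum]
      exact Finset.sum_congr rfl fun c _ => Real.sq_sqrt (mul_nonneg hC0 (hP0 c))
    have eb : ∑ c, (Real.sqrt (Qform m2 (vre c) (vre c)) + Real.sqrt (Qform m2 (vim c) (vim c))) ^ 2 ≤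
        2 * Qtot := by
      rw [hQtot, Finset.mul_sum]
      refine Finset.sum_le_sum fun c _ => ?_
      have hs1 := Real.sq_sqrt (hQ0 c)
      have hs2 := Real.sq_sqrt (hQ0' c)
      nlinarith [sq_nonneg (Real.sqrt (Qform m2 (vre c) (vre c)) - Real.sqrt (Qform m2 (vim c) (vim c)))]
    rw [ea] at cs
    have lhs0 : 0 ≤ ∑ c, Real.sqrt (C * P c) *
        (Real.sqrt (Qform m2 (vre c) (vre c)) + Real.sqrt (Qform m2 (vim c) (vim c))) :=
      Finset.sum_nonneg fun c _ => mul_nonneg (Real.sqrt_nonneg _)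
        (add_nonneg (Real.sqrt_nonneg _) (Real.sqrt_nonneg _))
    have hCP0 : 0 ≤ C * ∑ c, P c := mul_nonneg hC0 (Finset.sum_nonneg fun c _ => hP0 c)
    rw [← Real.sqrt_mul hCP0, Real.le_sqrt lhs0]
    · exact cs.trans (mul_le_mul_of_nonneg_left eb hCP0)
    · exact mul_nonneg hCP0 (by linarith)
  -- (6) Σ_c P c = ‖φ‖²  and  (1 − t)·Qtot ≤ ‖ψ‖²
  have hPsum : ∑ c, P c = ∑ i, ‖φ i‖ ^ 2 := by
    have e : ∀ c, P c = ∑ x, p c x ^ 2 := by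
      intro c
      apply Finset.sum_subset (Finset.subset_univ S)
      intro x _ hx
      rw [hpsupp c x hx]
      ring
    simp only [e, hp]
    exact sum_comp_site (fun x c => ‖φ (x, c)‖ ^ 2)
  have hQtot_le : (1 - t) * Qtot ≤ ∑ i, ‖ψ i‖ ^ 2 := by
    have hs := hSOS v
    rw [hv] at hs
    -- rewrite the left-hand side of hs as (1 - t) * Qtot
    have eQ : (1 - t) * Qtot = t ^ 2 * ∑ i, ‖v i‖ ^ 2 +
        (1 - t) * ∑ x, ∑ μ, ∑ a, ∑ α, ‖v (QuantumFieldTheory.Site.shift x μ, a, α) - v (x, a, α)‖ ^ 2 := by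
      have em : (1 - t) * m2 = t ^ 2 := by
        rw [hm2def]; field_simp
      have e1 : ∑ i, ‖v i‖ ^ 2 = ∑ c : Fin 3 × Fin 4, ∑ x, (vre c x * vre c x + vim c x * vim c x) := by
        rw [sum_comp_site (fun x c => vre c x * vre c x + vim c x * vim c x)]
        refine Finset.sum_congr rfl fun i _ => ?_
        simp only [hvre, hvim]
        rw [Complex.sq_norm, Complex.normSq_apply]
      have e2 : ∑ x, ∑ μ, ∑ a, ∑ α, ‖v (QuantumFieldTheory.Site.shift x μ, a, α) - v (x, a, α)‖ ^ 2 =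
          ∑ c : Fin 3 × Fin 4, ∑ x, ∑ μ,
            ((vre c (x + Pi.single μ 1) - vre c x) * (vre c (x + Pi.single μ 1) - vre c x) +
              (vim c (x + Pi.single μ 1) - vim c x) * (vim c (x + Pi.single μ 1) - vim c x)) := by
        rw [sum_comp_site_dir]
        refine Finset.sum_congr rfl fun x _ => Finset.sum_congr rfl fun μ _ =>
          Finset.sum_congr rfl fun a _ => Finset.sum_congr rfl fun α _ => ?_
        simp only [hvre, hvim]
        rw [Complex.sq_norm, Complex.normSq_apply, Complex.sub_re, Complex.sub_im]
        rfl
      rw [e1, e2, hQtot]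
      simp only [Qform]
      rw [Finset.mul_sum, Finset.mul_sum, Finset.mul_sum, ← Finset.sum_add_distrib]
      refine Finset.sum_congr rfl fun c _ => ?_
      simp only [Finset.sum_add_distrib]
      linear_combination ((∑ x, vre c x * vre c x) + ∑ x, vim c x * vim c x) * em
    rw [eQ]
    exact hs
  -- (7) the final algebra
  set X : ℝ := ∑ i, ‖ψ i‖ ^ 2 with hXdef
  set Φ : ℝ := ∑ i, ‖φ i‖ ^ 2 with hΦdef
  have hX0 : 0 ≤ X := Finset.sum_nonneg fun _ _ => by positivity
  have hΦ0 : 0 ≤ Φ := Finset.sum_nonneg fun _ _ => by positivity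
  have hmain : X ≤ Real.sqrt (C * Φ) * Real.sqrt (2 * Qtot) := by
    rw [hX]
    refine h3.trans ?_
    rw [h4]
    refine (Finset.sum_le_sum fun c _ => h5 c).trans ?_
    rw [hPsum] at h6
    exact h6
  -- square: X² ≤ C Φ · 2 Qtot ≤ C Φ · 2 X/(1−t)
  have hsq : X ^ 2 ≤ (C * Φ) * (2 * Qtot) := by
    have h1 : 0 ≤ Real.sqrt (C * Φ) * Real.sqrt (2 * Qtot) := by positivity
    calc X ^ 2 ≤ (Real.sqrt (C * Φ) * Real.sqrt (2 * Qtot)) ^ 2 := pow_le_pow_left₀ hX0 hmain 2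
      _ = (C * Φ) * (2 * Qtot) := by
          rw [mul_pow, Real.sq_sqrt (by positivity), Real.sq_sqrt (by positivity)]
  have hQX : Qtot ≤ X / (1 - t) := by
    rw [le_div_iff₀ h1t]
    linarith [hQtot_le]
  have hXle : X ≤ 2 * C * Φ / (1 - t) := by
    by_cases hX00 : X = 0
    · rw [hX00]; positivity
    · have hXpos : 0 < X := lt_of_le_of_ne hX0 (Ne.symm hX00)
      have : X * X ≤ (2 * C * Φ / (1 - t)) * X := by
        calc X * X = X ^ 2 := by ring
          _ ≤ (C * Φ) * (2 * Qtot) := hsq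
          _ ≤ (C * Φ) * (2 * (X / (1 - t))) := by
              apply mul_le_mul_of_nonneg_left _ (by positivity)
              linarith
          _ = (2 * C * Φ / (1 - t)) * X := by ring
      exact le_of_mul_le_mul_right this hXpos
  -- constants: 2C/(1−t) ≤ (8/3) C ≤ 4|S|(256/L + 1/3)
  have hA : 256 / (m2 * (L : ℝ) ^ 2) ≤ 256 / (L : ℝ) := by
    apply div_le_div_of_nonneg_left (by norm_num) hLpos
    have h := mul_le_mul_of_nonneg_right hm2 (sq_nonneg (L : ℝ))
    have hL0 : (L : ℝ) ≠ 0 := hLpos.ne'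
    have e : 1 / (L : ℝ) * (L : ℝ) ^ 2 = L := by
      rw [pow_two, ← mul_assoc, one_div, inv_mul_cancel₀ hL0, one_mul]
    linarith [h, e]
  have hCle : C ≤ (3 / 2) * S.card * (256 / (L : ℝ) + 1 / 3) := by
    rw [hC]
    apply mul_le_mul_of_nonneg_left _ (by positivity)
    linarith
  calc X ≤ 2 * C * Φ / (1 - t) := hXle
    _ ≤ 2 * C * Φ / (3 / 4) := by
        apply div_le_div_of_nonneg_left (by positivity) (by norm_num)
        linarith
    _ = (8 / 3) * C * Φ := by ring
    _ ≤ (8 / 3) * ((3 / 2) * S.card * (256 / (L : ℝ) + 1 / 3)) * Φ := by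
        apply mul_le_mul_of_nonneg_right _ hΦ0
        exact mul_le_mul_of_nonneg_left hCle (by norm_num)
    _ = (4 * S.card * (256 / (L : ℝ) + 1 / 3)) * Φ := by ring

end ComplexNoLeak


section NoLeakFromSOS

/-- **`NoLeakBarrier` from the sum-of-squares inequality** (only its adjoint half is used). -/
theorem noLeakBarrier_of_sos (h : HoleDominatesLaplacian) : NoLeakBarrier := by
  refine ⟨16, ?_⟩
  intro L _ hL t ht1 ht4 S ψ hsupp
  exact noLeak_of_adjoint_sos hL t ht1 ht4 _ (fun χ => (h L t χ).2) S ψ hsupp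

end NoLeakFromSOS


/-! ## The composition: SOS + diamagnetic ⇒ the crux, BY NAME (everything else is proved above or landed) -/

section Composition

/-- The registered `stub_diamagnetic` of the picked line, verbatim, as a hypothesis. -/
def Diamagnetic : Prop :=
  ∀ (L : ℕ) [NeZero L] (U : GaugeConfig 4 L ↥(Matrix.specialUnitaryGroup (Fin 3) ℂ))
    (ψ : TorusSite 4 L × Fin 3 × Fin 4 → ℂ) (x : TorusSite 4 L) (μ : Fin 4),
    (Real.sqrt (∑ a, ∑ α, ‖ψ (QuantumFieldTheory.Site.shift x μ, a, α)‖ ^ 2) -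
        Real.sqrt (∑ a, ∑ α, ‖ψ (x, a, α)‖ ^ 2)) ^ 2 ≤
      ∑ a, ∑ α, ‖(∑ b, (U (x, μ) : Matrix (Fin 3) (Fin 3) ℂ) a b *
          ψ (QuantumFieldTheory.Site.shift x μ, b, α)) - ψ (x, a, α)‖ ^ 2

theorem sum_norm_sq_eq_sum_site' {L : ℕ} [NeZero L] (ψ : TorusSite 4 L × Fin 3 × Fin 4 → ℂ) :
    ∑ i, ‖ψ i‖ ^ 2 = ∑ x, ∑ a, ∑ α, ‖ψ (x, a, α)‖ ^ 2 := by
  simp only [Fintype.sum_prod_type]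

theorem re_star_dotProduct_smul' {L : ℕ} [NeZero L] (ψ : TorusSite 4 L × Fin 3 × Fin 4 → ℂ) (t : ℝ) :
    (star ψ ⬝ᵥ ((t : ℂ) • ψ)).re = t * ∑ i, ‖ψ i‖ ^ 2 := by
  rw [dotProduct_smul, smul_eq_mul, Complex.re_ofReal_mul, re_star_dotProduct_self]

set_option maxHeartbeats 800000 in
/-- **THE CRUX FROM TWO FINITE-ALGEBRA FACTS.**  `HoleDominatesLaplacian` (the free sum-of-squares inequality, shared with
two other filed cards) and the registered sitewise Kato inequality `Diamagnetic` imply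
`SpectralDefectExtinction.TipNoBinding` BY NAME — everything else on the line (`d = 4` bubble, torus barrier, minimum
principle, Green kernel bound, spread, no-leak duality) is PROVED above, and positivity / perturbation are LANDED
(`stub_positivity` p72288, `stub_perturbation` p72301, imported).  Witnesses: `λ_R = 1/(1152·(5(2R+1)⁴)²)`,
`L₀ = max(L₁, L₂, 1536)`. -/
theorem tipNoBinding_of_sos (hsos : HoleDominatesLaplacian) (hdia : Diamagnetic) :
    Summit.QuantumFields.QCD.Theses.SpectralDefectExtinction.TipNoBinding := by
  have hpos := PositivityNoLeakSpread.stub_positivity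
  have hpert := PositivityNoLeakSpread.stub_perturbation
  obtain ⟨L₁, hspread⟩ := spreadBarrier_holds
  obtain ⟨L₂, hleak⟩ := noLeakBarrier_of_sos hsos
  classical
  intro R
  have hR0 : (0 : ℝ) ≤ R := Nat.cast_nonneg R
  have hn1 : (1 : ℝ) ≤ 5 * (2 * (R : ℝ) + 1) ^ 4 := by
    have h1 : (1 : ℝ) ≤ (2 * (R : ℝ) + 1) ^ 4 := one_le_pow₀ (by linarith only [hR0])
    linarith only [h1]
  set n : ℝ := 5 * (2 * (R : ℝ) + 1) ^ 4 with hndef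
  have hn0 : 0 < n := zero_lt_one.trans_le hn1
  have hlam : 0 < 1 / (1152 * n ^ 2) := by positivity
  refine ⟨1 / (1152 * n ^ 2), hlam, max (max L₁ L₂) 1536, ?_⟩
  intro L _ hL U hU t ht1 ht2 hdet
  have hL₁ : L₁ ≤ L := le_trans (le_trans (le_max_left _ _) (le_max_left _ _)) hL
  have hL₂ : L₂ ≤ L := le_trans (le_trans (le_max_right _ _) (le_max_left _ _)) hL
  have hL1536 : (1536 : ℝ) ≤ L := by exact_mod_cast le_trans (le_max_right _ _) hL
  have hLpos : (0 : ℝ) < L := by linarith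
  -- t is in the window
  have ht0 : 0 < t := lt_of_lt_of_le (by positivity) ht1
  have htlam : t * (1152 * n ^ 2) < 1 := (lt_div_iff₀ (by positivity)).mp ht2
  have ht1' : t ≤ 1 := by
    have : 1 / (1152 * n ^ 2) ≤ 1 := by
      rw [div_le_one (by positivity)]
      nlinarith [hn1]
    linarith
  have ht4 : t ≤ 1 / 4 := by
    have : 1 / (1152 * n ^ 2) ≤ 1 / 4 := by
      apply one_div_le_one_div_of_le (by norm_num)
      nlinarith [hn1]
    linarith
  have htL : 1 / (L : ℝ) ≤ t := by
    have h := pow_le_pow_left₀ (by positivity) ht1 2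
    rw [div_pow, one_pow, Real.sq_sqrt hLpos.le] at h
    nlinarith
  -- B := 256/L + 1/3 ≤ 1/2
  have hB : 256 / (L : ℝ) + 1 / 3 ≤ 1 / 2 := by
    have : 256 / (L : ℝ) ≤ 1 / 6 := by
      rw [div_le_div_iff₀ hLpos (by norm_num)]
      linarith
    linarith
  have hB0 : 0 ≤ 256 / (L : ℝ) + 1 / 3 := by positivity
  -- an eigenvector
  obtain ⟨ψ, hψne, hψ⟩ := Matrix.exists_mulVec_eq_zero_iff.mpr hdet
  have hEig : wilsonDirac (fundamentalRep (Fin 3)) U 0 1 *ᵥ ψ = (t : ℂ) • ψ := by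
    rw [Matrix.sub_mulVec, Matrix.smul_mulVec, Matrix.one_mulVec, sub_eq_zero] at hψ
    exact hψ
  set P : ℝ := ∑ i, ‖ψ i‖ ^ 2 with hPdef
  have hPpos : 0 < P := by
    obtain ⟨i, hi⟩ := Function.ne_iff.mp hψne
    exact Finset.sum_pos' (fun j _ => by positivity)
      ⟨i, Finset.mem_univ _, pow_pos (norm_pos_iff.mpr hi) 2⟩
  -- the site modulus f = |ψ|
  set f : TorusSite 4 L → ℝ := fun x => Real.sqrt (∑ a, ∑ α, ‖ψ (x, a, α)‖ ^ 2) with hfdef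
  have hsq0 : ∀ x, 0 ≤ ∑ a, ∑ α, ‖ψ (x, a, α)‖ ^ 2 := fun x =>
    Finset.sum_nonneg fun _ _ => Finset.sum_nonneg fun _ _ => by positivity
  have hfx : ∀ x, f x ^ 2 = ∑ a, ∑ α, ‖ψ (x, a, α)‖ ^ 2 := fun x => Real.sq_sqrt (hsq0 x)
  have hsumf : ∑ y, f y ^ 2 = P := by
    simp only [hfx, hPdef, sum_norm_sq_eq_sum_site']
  -- Kato: E(|ψ|) ≤ 2 t P
  have hE : ∑ y, ∑ μ, (f (QuantumFieldTheory.Site.shift y μ) - f y) ^ 2 ≤ 2 * t * P := by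
    have h1 : ∑ y, ∑ μ, (f (QuantumFieldTheory.Site.shift y μ) - f y) ^ 2 ≤
        ∑ x, ∑ μ, ∑ a, ∑ α, ‖(∑ b, (U (x, μ) : Matrix (Fin 3) (Fin 3) ℂ) a b *
          ψ (QuantumFieldTheory.Site.shift x μ, b, α)) - ψ (x, a, α)‖ ^ 2 :=
      Finset.sum_le_sum fun x _ => Finset.sum_le_sum fun μ _ => hdia L U ψ x μ
    have h2 : (star ψ ⬝ᵥ (wilsonDirac (fundamentalRep (Fin 3)) U 0 1 *ᵥ ψ)).re = t * P := by
      rw [hEig, re_star_dotProduct_smul']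
    have h3 := hpos L U ψ
    rw [h2] at h3
    linarith only [h1, h3]
  -- SPREAD on the support set of the perturbation
  obtain ⟨S, hcard, hpertψ⟩ := hpert R L U hU
  obtain ⟨hsupp, hnorm⟩ := hpertψ ψ
  have hc0 : (0 : ℝ) ≤ S.card := Nat.cast_nonneg _
  have hcn : (S.card : ℝ) ≤ n := by rw [hndef]; exact_mod_cast hcard
  have hmS : ∑ x ∈ S, ∑ a, ∑ α, ‖ψ (x, a, α)‖ ^ 2 ≤ (9 / 2) * t * n * (256 / (L : ℝ) + 1 / 3) * P := by
    have h := hspread L hL₁ f S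
    rw [hsumf] at h
    have e : ∑ x ∈ S, f x ^ 2 = ∑ x ∈ S, ∑ a, ∑ α, ‖ψ (x, a, α)‖ ^ 2 :=
      Finset.sum_congr rfl fun x _ => hfx x
    rw [← e]
    have hfac : (1 / (L : ℝ)) * P + ∑ y, ∑ μ, (f (QuantumFieldTheory.Site.shift y μ) - f y) ^ 2 ≤ 3 * t * P := by
      have : (1 / (L : ℝ)) * P ≤ t * P := mul_le_mul_of_nonneg_right htL hPpos.le
      linarith
    calc ∑ x ∈ S, f x ^ 2 ≤ ((1 / (L : ℝ)) * P + ∑ y, ∑ μ, (f (QuantumFieldTheory.Site.shift y μ) - f y) ^ 2) *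
          ((3 / 2) * S.card * (256 / (L : ℝ) + 1 / 3)) := h
      _ ≤ (3 * t * P) * ((3 / 2) * S.card * (256 / (L : ℝ) + 1 / 3)) :=
          mul_le_mul_of_nonneg_right hfac (by positivity)
      _ ≤ (3 * t * P) * ((3 / 2) * n * (256 / (L : ℝ) + 1 / 3)) := by
          apply mul_le_mul_of_nonneg_left _ (by positivity)
          apply mul_le_mul_of_nonneg_right _ hB0
          linarith
      _ = (9 / 2) * t * n * (256 / (L : ℝ) + 1 / 3) * P := by ring
  -- NO-LEAK
  have hφ : wilsonDirac (fundamentalRep (Fin 3))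
        (1 : GaugeConfig 4 L ↥(Matrix.specialUnitaryGroup (Fin 3) ℂ)) 0 1 *ᵥ ψ - (t : ℂ) • ψ =
      -((wilsonDirac (fundamentalRep (Fin 3)) U 0 1 -
          wilsonDirac (fundamentalRep (Fin 3))
            (1 : GaugeConfig 4 L ↥(Matrix.specialUnitaryGroup (Fin 3) ℂ)) 0 1) *ᵥ ψ) := by
    rw [Matrix.sub_mulVec, hEig, neg_sub]
  have hsuppφ : ∀ i : TorusSite 4 L × Fin 3 × Fin 4, i.1 ∉ S →
      (wilsonDirac (fundamentalRep (Fin 3))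
          (1 : GaugeConfig 4 L ↥(Matrix.specialUnitaryGroup (Fin 3) ℂ)) 0 1 *ᵥ ψ - (t : ℂ) • ψ) i = 0 := by
    intro i hi
    rw [hφ, Pi.neg_apply, hsupp i hi, neg_zero]
  have hC := hleak L hL₂ t ht1 ht4 S ψ hsuppφ
  have hφnorm : ∑ i, ‖(wilsonDirac (fundamentalRep (Fin 3))
        (1 : GaugeConfig 4 L ↥(Matrix.specialUnitaryGroup (Fin 3) ℂ)) 0 1 *ᵥ ψ - (t : ℂ) • ψ) i‖ ^ 2 =
      ∑ i, ‖((wilsonDirac (fundamentalRep (Fin 3)) U 0 1 -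
          wilsonDirac (fundamentalRep (Fin 3))
            (1 : GaugeConfig 4 L ↥(Matrix.specialUnitaryGroup (Fin 3) ℂ)) 0 1) *ᵥ ψ) i‖ ^ 2 := by
    simp only [hφ, Pi.neg_apply, norm_neg]
  rw [hφnorm] at hC
  set Q : ℝ := ∑ i, ‖((wilsonDirac (fundamentalRep (Fin 3)) U 0 1 -
      wilsonDirac (fundamentalRep (Fin 3))
        (1 : GaugeConfig 4 L ↥(Matrix.specialUnitaryGroup (Fin 3) ℂ)) 0 1) *ᵥ ψ) i‖ ^ 2 with hQdef
  -- the chain P ≤ 4|S|B · 256 · (9/2) t n B P ≤ 1152 n² t P < P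
  have hchain : P ≤ 4608 * n ^ 2 * (256 / (L : ℝ) + 1 / 3) ^ 2 * t * P := by
    calc P ≤ (4 * S.card * (256 / (L : ℝ) + 1 / 3)) * Q := hC
      _ ≤ (4 * n * (256 / (L : ℝ) + 1 / 3)) * Q := by
          apply mul_le_mul_of_nonneg_right _ (Finset.sum_nonneg fun _ _ => by positivity)
          apply mul_le_mul_of_nonneg_right _ hB0
          linarith
      _ ≤ (4 * n * (256 / (L : ℝ) + 1 / 3)) * (256 * ((9 / 2) * t * n * (256 / (L : ℝ) + 1 / 3) * P)) := by
          apply mul_le_mul_of_nonneg_left (hnorm.trans (mul_le_mul_of_nonneg_left hmS (by norm_num)))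
          positivity
      _ = 4608 * n ^ 2 * (256 / (L : ℝ) + 1 / 3) ^ 2 * t * P := by ring
  have hsmall : 4608 * n ^ 2 * (256 / (L : ℝ) + 1 / 3) ^ 2 * t < 1 := by
    have hB2 : (256 / (L : ℝ) + 1 / 3) ^ 2 ≤ 1 / 4 := by nlinarith [hB, hB0]
    calc 4608 * n ^ 2 * (256 / (L : ℝ) + 1 / 3) ^ 2 * t ≤ 4608 * n ^ 2 * (1 / 4) * t := by
          apply mul_le_mul_of_nonneg_right _ ht0.le
          exact mul_le_mul_of_nonneg_left hB2 (by positivity)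
      _ = t * (1152 * n ^ 2) := by ring
      _ < 1 := htlam
  have hlt : 4608 * n ^ 2 * (256 / (L : ℝ) + 1 / 3) ^ 2 * t * P < P := by
    have := mul_lt_mul_of_pos_right hsmall hPpos
    linarith
  exact absurd hchain (not_le.mpr hlt)

end Composition

end

end Summit.QuantumFields.QCD.Cruxes.TipNoBinding.IdeasK2G2
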